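import Literature.ModelTheory.ExponentialFields.SemialgebraicFlatReparam
import HarnessLib

/-!
# Fibrewise smoothing with a parameter (Pawłucki's Lemma 5.1 for `p = 1`)

Topic `Literature/ModelTheory/ExponentialFields` — block B5 of the proof of the
`C¹`-triangulation theorem for compact semialgebraic sets
(`Literature.ModelTheory.ExponentialFields.OhmotoShiota2017_c1Triangulation`, statement of
[OhmotoShiota2017, Thm. 1.1]) along the correct proof of [Pawlucki2024], specialized to `p = 1`.

**Setting** (product form `B × ℝ`, `B = ℝᵐ` the parameter space, everything relative to a compact
`D ⊆ B`). A *laminar family* `α₀ ≤ α₁ ≤ ⋯ ≤ α_r` of continuous functions on `D` cuts the total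
capsule `[α₀, α_r] = {(x,t) : x ∈ D, α₀(x) ≤ t ≤ α_r(x)}` into the pieces `[α_i, α_{i+1}]`; a
continuous map `f = (f_ν) : [α₀, α_r] → ℝᵈ` has, on the open pieces `(α_i, α_{i+1})` with index in
`K₁`, a continuous `t`-derivative `g_ν = ∂_t f_ν`, and on each such piece one of the two cases of
[Pawlucki2024, (5.1.7)/(5.1.8)–(5.1.9)] holds: (I) `|g_ν| ≤ c` for all `ν`, or (II) for a
distinguished component `μ = μ(i)`, `|g_μ| ≥ c⁻¹` and `|g_ν| ≤ c |g_μ|` (the refinement producing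
this dichotomy is block B2).

**Construction** [Pawlucki2024, proof of Lemma 5.1, "Case I / Case II" = the trick of
Coste–Reguiat]: the fibrewise map `η(x, ·)` with `η(x, α₀) = α₀` and, on `[α_i, α_{i+1}]`,
`η = η(x, α_i) + (t - α_i)` in case I and `η = η(x, α_i) + |f_μ(x,t) - f_μ(x,α_i)|` in case II
(written as one sum of clamped contributions, `crEta`); its node values `β_i = η(x, α_i)`
(`crBeta`); its fibrewise inverse `ψ` (`crPsi`, continuous by compactness); then the flat
reparametrization of block B1 through the nodes `β`, `φ(x, s) = ψ(x, ω_{β(x)}(s))` (`crPhi`) with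
source nodes `δ_i = κ_i(β(x))` (`crDelta`).  Outputs (Pawłucki's (5.1.1)–(5.1.6) for `p = 1`):
`Φ(x,s) = (x, φ(x,s))` is a fibre-preserving homeomorphism `[δ₀, δ_r] → [α₀, α_r]` mapping the
`i`-th piece onto the `i`-th piece; `∂_s φ` exists everywhere, is jointly continuous and vanishes
at all nodes (so it extends by zero to the boundary of every capsule); the same for
`∂_s (f_ν ∘ Φ)` on the `K₁`-pieces; and the normal forms `φ = α_i + ω - β_i` (case I),
`f_μ(x, φ) = f_μ(x, α_i) ± (ω - β_i)` (case II), which make `(u, s) ↦ φ(h(u), s)` of class `C¹`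
once the finitely many continuous coefficient functions are smoothed [Pawlucki2024, (8.1.15)–(8.1.16)].

For `p = 1` no refinement for second derivatives ((5.1.10)–(5.1.13)) and no Yomdin–Gromov lemma
are needed: the source pieces correspond one-to-one to the target pieces.

No named facts are introduced (D-0026).

## References

* [Pawlucki2024] W. Pawłucki, *Strict `C^p`-triangulations — a new approach to
  desingularization*, J. Eur. Math. Soc. 26 (2024), 3863–3909, Lemma 5.1 and its proof,
  (5.1.1)–(5.1.9); §1 (the one-dimensional case, trick of Coste–Reguiat).
* [CosteReguiat1992] M. Coste, M. Reguiat, *Trivialités en famille*, in: Real Algebraic Geometry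
  (Rennes 1991), LNM 1524, Springer 1992, 193–204 (cited through [Pawlucki2024]).
* [OhmotoShiota2017] T. Ohmoto, M. Shiota, *`C¹`-triangulations of semialgebraic sets*,
  J. Topology 10 (2017), 765–775, Thm. 1.1 (statement only).
-/

noncomputable section

open Set Filter Finset
open _root_.Topology

namespace Literature.ModelTheory.ExponentialFields

open Literature.NumberTheory.Transcendental (IsSemialgebraicFunOn IsSemialgebraicMapOn
  isSemialgebraicFunOn_iff)

section FibreSmoothing

variable {B : Type*} {d : ℕ}

/-! ### Laminar families and their capsules (product form) -/

/-- The total capsule `[α₀, α_r]` of a laminar family over `D`. [cite: Pawlucki2024, Lemma 5.1] -/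
def lamTotal (D : Set B) (α : ℕ → B → ℝ) (r : ℕ) : Set (B × ℝ) :=
  {p | p.1 ∈ D ∧ α 0 p.1 ≤ p.2 ∧ p.2 ≤ α r p.1}

/-- The closed piece `[α_i, α_{i+1}]` over `D`. [cite: Pawlucki2024, Lemma 5.1] -/
def lamPiece (D : Set B) (α : ℕ → B → ℝ) (i : ℕ) : Set (B × ℝ) :=
  {p | p.1 ∈ D ∧ α i p.1 ≤ p.2 ∧ p.2 ≤ α (i + 1) p.1}

/-- The (fibrewise) open piece `(α_i, α_{i+1})` over `D`. [cite: Pawlucki2024, Lemma 5.1] -/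
def lamOpenPiece (D : Set B) (α : ℕ → B → ℝ) (i : ℕ) : Set (B × ℝ) :=
  {p | p.1 ∈ D ∧ α i p.1 < p.2 ∧ p.2 < α (i + 1) p.1}

variable {D : Set B} {α : ℕ → B → ℝ} {r : ℕ}

/-- Pieces lie in the total capsule. [cite: Pawlucki2024, Lemma 5.1] -/
theorem lamPiece_subset_lamTotal (hm : ∀ x ∈ D, Monotone fun j => α j x) {i : ℕ} (hi : i < r) :
    lamPiece D α i ⊆ lamTotal D α r := fun p hp =>
  ⟨hp.1, (hm p.1 hp.1 (Nat.zero_le i)).trans hp.2.1,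
    hp.2.2.trans (hm p.1 hp.1 (Nat.succ_le_of_lt hi))⟩

/-- Open pieces lie in closed pieces. [cite: Pawlucki2024, Lemma 5.1] -/
theorem lamOpenPiece_subset_lamPiece (i : ℕ) : lamOpenPiece D α i ⊆ lamPiece D α i :=
  fun _ hp => ⟨hp.1, hp.2.1.le, hp.2.2.le⟩

/-- Every point of the total capsule lies in some closed piece. [cite: Pawlucki2024, Lemma 5.1] -/
theorem exists_mem_lamPiece_of_mem_lamTotal
    {p : B × ℝ} (hp : p ∈ lamTotal D α r) : r = 0 ∨ ∃ i < r, p ∈ lamPiece D α i := by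
  obtain ⟨hx, h0, hr⟩ := hp
  induction r with
  | zero => exact Or.inl rfl
  | succ r ih =>
    right
    by_cases h : p.2 ≤ α r p.1
    · rcases ih h with h' | ⟨i, hi, hpi⟩
      · subst h'; exact ⟨0, Nat.zero_lt_succ _, hx, h0, hr⟩
      · exact ⟨i, Nat.lt_succ_of_lt hi, hpi⟩
    · exact ⟨r, Nat.lt_succ_self r, hx, (not_le.1 h).le, hr⟩

/-- **The total capsule over a compact base is compact** (image of `D × [0,1]`).
[cite: Pawlucki2024, Lemma 5.1] -/
theorem isCompact_lamTotal [TopologicalSpace B] (hD : IsCompact D) (hc : ∀ j, ContinuousOn (α j) D)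
    (hm : ∀ x ∈ D, Monotone fun j => α j x) (r : ℕ) : IsCompact (lamTotal D α r) := by
  have hcont : ContinuousOn (fun q : B × ℝ => (q.1, (1 - q.2) * α 0 q.1 + q.2 * α r q.1))
      (D ×ˢ Icc (0:ℝ) 1) := by
    refine continuousOn_fst.prodMk ?_
    refine ((continuousOn_const.sub continuousOn_snd).mul ((hc 0).comp continuousOn_fst
      fun q hq => hq.1)).add (continuousOn_snd.mul ((hc r).comp continuousOn_fst fun q hq => hq.1))
  have himage : (fun q : B × ℝ => (q.1, (1 - q.2) * α 0 q.1 + q.2 * α r q.1)) '' (D ×ˢ Icc (0:ℝ) 1) =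
      lamTotal D α r := by
    ext p
    constructor
    · rintro ⟨q, ⟨hq1, hq2⟩, rfl⟩
      have hle : α 0 q.1 ≤ α r q.1 := hm q.1 hq1 (Nat.zero_le r)
      refine ⟨hq1, ?_, ?_⟩ <;> dsimp only <;> nlinarith [hq2.1, hq2.2]
    · rintro ⟨hx, h0, hr⟩
      rcases eq_or_lt_of_le (h0.trans hr) with heq | hlt
      · refine ⟨(p.1, 0), ⟨hx, by norm_num⟩, ?_⟩
        ext <;> simp
        linarith
      · refine ⟨(p.1, (p.2 - α 0 p.1) / (α r p.1 - α 0 p.1)), ⟨hx, ?_, ?_⟩, ?_⟩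
        · exact div_nonneg (sub_nonneg.2 h0) (sub_nonneg.2 hlt.le)
        · rw [div_le_one (sub_pos.2 hlt)]; linarith
        · ext
          · simp
          · simp only
            field_simp
            ring
  rw [← himage]
  exact (hD.prod isCompact_Icc).image_of_continuousOn hcont

/-! ### The Coste–Reguiat map `η` -/

/-- Clamp of `t` into the `i`-th fibre interval `[α_i(x), α_{i+1}(x)]`. [cite: Pawlucki2024, Lemma 5.1] -/
def crClamp (α : ℕ → B → ℝ) (i : ℕ) (x : B) (t : ℝ) : ℝ := max (α i x) (min t (α (i + 1) x))

/-- Contribution of the `i`-th piece to `η`: `t' - α_i` (case I) or `|f_μ(x,t') - f_μ(x,α_i)|`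
(case II), `t'` the clamp of `t`. [cite: Pawlucki2024, proof of Lemma 5.1, Cases I/II] -/
def crContrib (α : ℕ → B → ℝ) (f : B → ℝ → Fin d → ℝ) (caseII : ℕ → Bool) (μ : ℕ → Fin d)
    (i : ℕ) (x : B) (t : ℝ) : ℝ :=
  if caseII i then |f x (crClamp α i x t) (μ i) - f x (α i x) (μ i)| else crClamp α i x t - α i x

/-- **The Coste–Reguiat map** `η(x, t) = α₀(x) + ∑_{i<r} contrib_i(x, t)`: strictly increasing in
`t` on `[α₀, α_r]`, defined so that `t` and all `f_ν` become `c`-Lipschitz functions of `η`.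
[cite: Pawlucki2024, proof of Lemma 5.1] -/
def crEta (α : ℕ → B → ℝ) (f : B → ℝ → Fin d → ℝ) (caseII : ℕ → Bool) (μ : ℕ → Fin d) (r : ℕ)
    (x : B) (t : ℝ) : ℝ :=
  α 0 x + ∑ i ∈ range r, crContrib α f caseII μ i x t

/-- The new nodes `β_i(x) = η(x, α_i(x))`. [cite: Pawlucki2024, proof of Lemma 5.1] -/
def crBeta (α : ℕ → B → ℝ) (f : B → ℝ → Fin d → ℝ) (caseII : ℕ → Bool) (μ : ℕ → Fin d) (r : ℕ)
    (i : ℕ) (x : B) : ℝ :=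
  crEta α f caseII μ r x (α i x)

variable {f : B → ℝ → Fin d → ℝ} {caseII : ℕ → Bool} {μ : ℕ → Fin d} {i : ℕ}

/-- The clamp lies in the fibre interval. [cite: Pawlucki2024, Lemma 5.1] -/
theorem crClamp_mem {x : B} (hx : α i x ≤ α (i + 1) x) (t : ℝ) :
    crClamp α i x t ∈ Icc (α i x) (α (i + 1) x) :=
  ⟨le_max_left _ _, max_le hx (min_le_right _ _)⟩

/-- The clamp of a point of the interval is the point. [cite: Pawlucki2024, Lemma 5.1] -/
theorem crClamp_of_mem {x : B} {t : ℝ} (ht : t ∈ Icc (α i x) (α (i + 1) x)) : crClamp α i x t = t := by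
  unfold crClamp
  rw [min_eq_left ht.2, max_eq_right ht.1]

/-- Below the interval the clamp is `α_i`. [cite: Pawlucki2024, Lemma 5.1] -/
theorem crClamp_of_le {x : B} {t : ℝ} (ht : t ≤ α i x) : crClamp α i x t = α i x := by
  unfold crClamp
  exact max_eq_left ((min_le_left _ _).trans ht)

/-- Above the interval the clamp is `α_{i+1}`. [cite: Pawlucki2024, Lemma 5.1] -/
theorem crClamp_of_ge {x : B} (hx : α i x ≤ α (i + 1) x) {t : ℝ} (ht : α (i + 1) x ≤ t) :
    crClamp α i x t = α (i + 1) x := by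
  unfold crClamp
  rw [min_eq_right ht, max_eq_right hx]

/-- The clamp is monotone in `t`. [cite: Pawlucki2024, Lemma 5.1] -/
theorem crClamp_mono (i : ℕ) (x : B) : Monotone (crClamp α i x) :=
  fun _ _ h => max_le_max le_rfl (min_le_min h le_rfl)

/-- The contribution vanishes below the interval. [cite: Pawlucki2024, Lemma 5.1] -/
theorem crContrib_of_le {x : B} {t : ℝ} (ht : t ≤ α i x) : crContrib α f caseII μ i x t = 0 := by
  unfold crContrib
  rw [crClamp_of_le ht]
  split_ifs <;> simp

/-- The contribution is nonnegative. [cite: Pawlucki2024, Lemma 5.1] -/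
theorem crContrib_nonneg {x : B} (hx : α i x ≤ α (i + 1) x) (t : ℝ) :
    0 ≤ crContrib α f caseII μ i x t := by
  unfold crContrib
  split_ifs
  · exact abs_nonneg _
  · exact sub_nonneg.2 (crClamp_mem hx t).1

/-- The full contribution of the `i`-th piece (its value above the interval).
[cite: Pawlucki2024, Lemma 5.1] -/
theorem crContrib_of_ge {x : B} (hx : α i x ≤ α (i + 1) x) {t : ℝ} (ht : α (i + 1) x ≤ t) :
    crContrib α f caseII μ i x t = crContrib α f caseII μ i x (α (i + 1) x) := by
  unfold crContrib
  rw [crClamp_of_ge hx ht, crClamp_of_mem ⟨hx, le_rfl⟩]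

/-- `η(x, α₀(x)) = α₀(x)`, i.e. `β₀ = α₀`. [cite: Pawlucki2024, Lemma 5.1] -/
theorem crBeta_zero {x : B} (hm : Monotone fun j => α j x) : crBeta α f caseII μ r 0 x = α 0 x := by
  unfold crBeta crEta
  rw [sum_eq_zero fun i _ => crContrib_of_le (hm (Nat.zero_le i)), add_zero]

/-- **`η` on the `i`-th piece**: `η(x,t) = β_i(x) + contrib_i(x,t)` for `t ∈ [α_i, α_{i+1}]`, `i < r`.
[cite: Pawlucki2024, proof of Lemma 5.1] -/
theorem crEta_eq_of_mem {x : B} (hm : Monotone fun j => α j x) {i : ℕ} (hi : i < r) {t : ℝ}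
    (ht : t ∈ Icc (α i x) (α (i + 1) x)) :
    crEta α f caseII μ r x t = crBeta α f caseII μ r i x + crContrib α f caseII μ i x t := by
  unfold crBeta crEta
  rw [add_assoc, add_left_cancel_iff]
  rw [← sum_range_add_sum_Ico _ hi.le, ← sum_range_add_sum_Ico _ hi.le]
  have h1 : ∑ j ∈ range i, crContrib α f caseII μ j x t =
      ∑ j ∈ range i, crContrib α f caseII μ j x (α i x) := by
    refine sum_congr rfl fun j hj => ?_
    have hj := mem_range.1 hj
    have hxj : α j x ≤ α (j + 1) x := hm (Nat.le_succ j)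
    have hji : α (j + 1) x ≤ α i x := hm (Nat.succ_le_of_lt hj)
    rw [crContrib_of_ge hxj (hji.trans ht.1), crContrib_of_ge hxj hji]
  have h2 : ∑ j ∈ Ico i r, crContrib α f caseII μ j x (α i x) = 0 :=
    sum_eq_zero fun j hj => crContrib_of_le (hm (mem_Ico.1 hj).1)
  rw [Finset.sum_eq_sum_Ico_succ_bot hi (fun k => crContrib α f caseII μ k x t)]
  have h3 : ∑ j ∈ Ico (i + 1) r, crContrib α f caseII μ j x t = 0 :=
    sum_eq_zero fun j hj => crContrib_of_le (ht.2.trans (hm (mem_Ico.1 hj).1))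
  rw [h1, h2, h3]
  ring

/-- `η` at the nodes: `η(x, α_{i+1}) = β_{i+1} = β_i + (full contribution of piece i)`.
[cite: Pawlucki2024, proof of Lemma 5.1] -/
theorem crBeta_succ {x : B} (hm : Monotone fun j => α j x) {i : ℕ} (hi : i < r) :
    crBeta α f caseII μ r (i + 1) x =
      crBeta α f caseII μ r i x + crContrib α f caseII μ i x (α (i + 1) x) := by
  have h := crEta_eq_of_mem (f := f) (caseII := caseII) (μ := μ) hm hi
    ⟨hm (Nat.le_succ i), le_refl (α (i + 1) x)⟩
  exact h

/-- The new nodes increase: `β_i ≤ β_{i+1}` (`i < r`). [cite: Pawlucki2024, proof of Lemma 5.1] -/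
theorem crBeta_le_succ {x : B} (hm : Monotone fun j => α j x) {i : ℕ} (hi : i < r) :
    crBeta α f caseII μ r i x ≤ crBeta α f caseII μ r (i + 1) x := by
  rw [crBeta_succ hm hi]
  exact le_add_of_nonneg_right (crContrib_nonneg (hm (Nat.le_succ i)) _)

/-- `η` is monotone in `t`. [cite: Pawlucki2024, proof of Lemma 5.1] -/
theorem crEta_mono {x : B} (hm : Monotone fun j => α j x)
    (hII : ∀ i < r, caseII i = true → MonotoneOn (f x · (μ i)) (Icc (α i x) (α (i + 1) x)) ∨
      AntitoneOn (f x · (μ i)) (Icc (α i x) (α (i + 1) x))) :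
    Monotone (crEta α f caseII μ r x) := by
  intro t t' htt'
  unfold crEta
  refine add_le_add le_rfl (sum_le_sum fun i hi => ?_)
  have hir := mem_range.1 hi
  have hx : α i x ≤ α (i + 1) x := hm (Nat.le_succ i)
  unfold crContrib
  have hc := crClamp_mono (α := α) i x htt'
  have hm1 := crClamp_mem (α := α) hx t
  have hm2 := crClamp_mem (α := α) hx t'
  by_cases hcase : caseII i = true
  · rw [if_pos hcase, if_pos hcase]
    rcases hII i hir hcase with hmono | hanti
    · have h0 : f x (α i x) (μ i) ≤ f x (crClamp α i x t) (μ i) := hmono ⟨le_rfl, hx⟩ hm1 hm1.1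
      rw [abs_of_nonneg (sub_nonneg.2 h0), abs_of_nonneg (sub_nonneg.2 (h0.trans (hmono hm1 hm2 hc)))]
      exact sub_le_sub_right (hmono hm1 hm2 hc) _
    · have h0 : f x (crClamp α i x t) (μ i) ≤ f x (α i x) (μ i) := hanti ⟨le_rfl, hx⟩ hm1 hm1.1
      rw [abs_of_nonpos (sub_nonpos.2 h0), abs_of_nonpos (sub_nonpos.2 ((hanti hm1 hm2 hc).trans h0))]
      linarith [hanti hm1 hm2 hc]
  · rw [if_neg hcase, if_neg hcase]
    exact sub_le_sub_right hc _

/-! ### Fibrewise pieces and strict monotonicity of `η` -/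

/-- Every `t ∈ [α₀(x), α_r(x))` lies in a piece `[α_i(x), α_{i+1}(x))` (necessarily
nondegenerate), `i < r`. [cite: Pawlucki2024, Lemma 5.1] -/
theorem exists_fibre_piece {x : B} {t : ℝ} (h0 : α 0 x ≤ t) (hr : t < α r x) :
    ∃ i < r, α i x ≤ t ∧ t < α (i + 1) x := by
  induction r with
  | zero => exact absurd h0 (not_le.2 hr)
  | succ r ih =>
    by_cases h : t < α r x
    · obtain ⟨i, hi, h1, h2⟩ := ih h
      exact ⟨i, Nat.lt_succ_of_lt hi, h1, h2⟩
    · exact ⟨r, Nat.lt_succ_self r, le_of_not_gt h, hr⟩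

/-- The contribution of a piece is strictly increasing in `t` across the piece, provided (in
case II) `f_μ(x, ·)` is strictly monotone there. [cite: Pawlucki2024, proof of Lemma 5.1] -/
theorem crContrib_lt_crContrib {x : B} (hII : caseII i = true →
      StrictMonoOn (f x · (μ i)) (Icc (α i x) (α (i + 1) x)) ∨
        StrictAntiOn (f x · (μ i)) (Icc (α i x) (α (i + 1) x)))
    {t t' : ℝ} (ht : α i x ≤ t) (htt' : t < t') (ht' : t' ≤ α (i + 1) x) :
    crContrib α f caseII μ i x t < crContrib α f caseII μ i x t' := by
  have hx : α i x ≤ α (i + 1) x := ht.trans (htt'.le.trans ht')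
  have hmt : t ∈ Icc (α i x) (α (i + 1) x) := ⟨ht, htt'.le.trans ht'⟩
  have hmt' : t' ∈ Icc (α i x) (α (i + 1) x) := ⟨ht.trans htt'.le, ht'⟩
  unfold crContrib
  rw [crClamp_of_mem hmt, crClamp_of_mem hmt']
  by_cases hcase : caseII i = true
  · rw [if_pos hcase, if_pos hcase]
    rcases hII hcase with hmono | hanti
    · have h0 : f x (α i x) (μ i) ≤ f x t (μ i) := hmono.monotoneOn ⟨le_rfl, hx⟩ hmt ht
      have h1 : f x t (μ i) < f x t' (μ i) := hmono hmt hmt' htt'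
      rw [abs_of_nonneg (sub_nonneg.2 h0), abs_of_nonneg (sub_nonneg.2 (h0.trans h1.le))]
      linarith
    · have h0 : f x t (μ i) ≤ f x (α i x) (μ i) := hanti.antitoneOn ⟨le_rfl, hx⟩ hmt ht
      have h1 : f x t' (μ i) < f x t (μ i) := hanti hmt hmt' htt'
      rw [abs_of_nonpos (sub_nonpos.2 h0), abs_of_nonpos (sub_nonpos.2 (h1.le.trans h0))]
      linarith
  · rw [if_neg hcase, if_neg hcase]
    linarith

/-- Monotonicity hypothesis in the weak form used by `crEta_mono`, from the strict form.
[cite: Pawlucki2024, proof of Lemma 5.1] -/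
theorem monotoneOn_or_antitoneOn_of_strict {g : ℝ → ℝ} {s : Set ℝ}
    (h : StrictMonoOn g s ∨ StrictAntiOn g s) : MonotoneOn g s ∨ AntitoneOn g s :=
  h.imp StrictMonoOn.monotoneOn StrictAntiOn.antitoneOn

/-- **`η(x, ·)` is strictly increasing on `[α₀(x), α_r(x)]`.** [cite: Pawlucki2024, proof of Lemma 5.1] -/
theorem crEta_strictMonoOn {x : B} (hm : Monotone fun j => α j x)
    (hII : ∀ i < r, caseII i = true → StrictMonoOn (f x · (μ i)) (Icc (α i x) (α (i + 1) x)) ∨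
      StrictAntiOn (f x · (μ i)) (Icc (α i x) (α (i + 1) x))) :
    StrictMonoOn (crEta α f caseII μ r x) (Icc (α 0 x) (α r x)) := by
  have hmono : Monotone (crEta α f caseII μ r x) :=
    crEta_mono hm fun i hi hc => monotoneOn_or_antitoneOn_of_strict (hII i hi hc)
  intro t ht t' ht' htt'
  obtain ⟨i, hi, h1, h2⟩ := exists_fibre_piece ht.1 (htt'.trans_le ht'.2)
  set t'' := min t' (α (i + 1) x) with ht''
  have htt'' : t < t'' := lt_min htt' h2
  have h3 : t'' ≤ α (i + 1) x := min_le_right _ _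
  have hlt : crEta α f caseII μ r x t < crEta α f caseII μ r x t'' := by
    rw [crEta_eq_of_mem hm hi ⟨h1, h2.le⟩, crEta_eq_of_mem hm hi ⟨h1.trans htt''.le, h3⟩]
    exact (add_lt_add_iff_left _).2 (crContrib_lt_crContrib (hII i hi) h1 htt'' h3)
  exact hlt.trans_le (hmono (min_le_left _ _))

/-- `η` maps the fibre `[α₀, α_r]` into `[β₀, β_r]`. [cite: Pawlucki2024, proof of Lemma 5.1] -/
theorem crEta_mem_Icc {x : B} (hm : Monotone fun j => α j x)
    (hII : ∀ i < r, caseII i = true → MonotoneOn (f x · (μ i)) (Icc (α i x) (α (i + 1) x)) ∨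
      AntitoneOn (f x · (μ i)) (Icc (α i x) (α (i + 1) x))) {t : ℝ} (ht : t ∈ Icc (α 0 x) (α r x)) :
    crEta α f caseII μ r x t ∈ Icc (crBeta α f caseII μ r 0 x) (crBeta α f caseII μ r r x) :=
  ⟨crEta_mono hm hII ht.1, crEta_mono hm hII ht.2⟩

/-- The new nodes are monotone in the index (up to `r`). [cite: Pawlucki2024, proof of Lemma 5.1] -/
theorem crBeta_mono {x : B} (hm : Monotone fun j => α j x)
    (hII : ∀ i < r, caseII i = true → MonotoneOn (f x · (μ i)) (Icc (α i x) (α (i + 1) x)) ∨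
      AntitoneOn (f x · (μ i)) (Icc (α i x) (α (i + 1) x))) {i j : ℕ} (hij : i ≤ j) :
    crBeta α f caseII μ r i x ≤ crBeta α f caseII μ r j x :=
  crEta_mono hm hII (hm hij)

/-! ### Hypotheses of the construction (topological layer) -/

variable [TopologicalSpace B]

/-- The standing hypotheses of [Pawlucki2024, Lemma 5.1] (topological part): compact base,
continuous laminar family, `f` continuous on the total capsule, and — in case II — strict
monotonicity of the distinguished component along the fibres of the piece (consequence of
`|∂_t f_μ| ≥ c⁻¹`, see `CRDerivHyp`). [cite: Pawlucki2024, Lemma 5.1, (5.1.8)] -/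
structure CRHyp (D : Set B) (α : ℕ → B → ℝ) (r : ℕ) (f : B → ℝ → Fin d → ℝ) (caseII : ℕ → Bool)
    (μ : ℕ → Fin d) : Prop where
  compact : IsCompact D
  cont : ∀ j, ContinuousOn (α j) D
  mono : ∀ x ∈ D, Monotone fun j => α j x
  fcont : ContinuousOn (fun p : B × ℝ => f p.1 p.2) (lamTotal D α r)
  strict : ∀ i < r, caseII i = true → ∀ x ∈ D,
    StrictMonoOn (f x · (μ i)) (Icc (α i x) (α (i + 1) x)) ∨
      StrictAntiOn (f x · (μ i)) (Icc (α i x) (α (i + 1) x))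

/-- `max`/`min` of functions continuous on a set (the clamp). [folklore] -/
theorem continuousOn_clamp {X : Type*} [TopologicalSpace X] {a b g : X → ℝ} {s : Set X}
    (ha : ContinuousOn a s) (hb : ContinuousOn b s) (hg : ContinuousOn g s) :
    ContinuousOn (fun x => max (a x) (min (g x) (b x))) s :=
  continuous_max.comp_continuousOn (ha.prodMk (continuous_min.comp_continuousOn (hg.prodMk hb)))

namespace CRHyp

variable (H : CRHyp D α r f caseII μ)
include H

/-- Weak monotonicity in case II. [cite: Pawlucki2024, proof of Lemma 5.1] -/
theorem weak {x : B} (hx : x ∈ D) : ∀ i < r, caseII i = true →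
    MonotoneOn (f x · (μ i)) (Icc (α i x) (α (i + 1) x)) ∨
      AntitoneOn (f x · (μ i)) (Icc (α i x) (α (i + 1) x)) :=
  fun i hi hc => monotoneOn_or_antitoneOn_of_strict (H.strict i hi hc x hx)

/-- `η(x, ·)` is strictly increasing on the fibre. [cite: Pawlucki2024, proof of Lemma 5.1] -/
theorem eta_strictMonoOn {x : B} (hx : x ∈ D) :
    StrictMonoOn (crEta α f caseII μ r x) (Icc (α 0 x) (α r x)) :=
  crEta_strictMonoOn (H.mono x hx) fun i hi hc => H.strict i hi hc x hx

/-- Continuity of `(x, t) ↦ f(x, clamp_i(x, t))` on `D × ℝ`. [cite: Pawlucki2024, Lemma 5.1] -/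
theorem continuousOn_f_clamp {i : ℕ} (hi : i < r) :
    ContinuousOn (fun p : B × ℝ => f p.1 (crClamp α i p.1 p.2)) {p : B × ℝ | p.1 ∈ D} := by
  have h1 : ContinuousOn (fun p : B × ℝ => α i p.1) {p : B × ℝ | p.1 ∈ D} :=
    (H.cont i).comp continuousOn_fst fun p hp => hp
  have h2 : ContinuousOn (fun p : B × ℝ => α (i + 1) p.1) {p : B × ℝ | p.1 ∈ D} :=
    (H.cont (i + 1)).comp continuousOn_fst fun p hp => hp
  have hcl : ContinuousOn (fun p : B × ℝ => (p.1, crClamp α i p.1 p.2)) {p : B × ℝ | p.1 ∈ D} := by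
    refine continuousOn_fst.prodMk ?_
    unfold crClamp
    exact continuousOn_clamp h1 h2 continuousOn_snd
  refine H.fcont.comp hcl fun p hp => ?_
  have hx : α i p.1 ≤ α (i + 1) p.1 := H.mono p.1 hp (Nat.le_succ i)
  have hm := crClamp_mem (α := α) hx p.2
  exact lamPiece_subset_lamTotal H.mono hi ⟨hp, hm.1, hm.2⟩

/-- Continuity of `x ↦ f(x, α_i(x))` on `D`. [cite: Pawlucki2024, Lemma 5.1] -/
theorem continuousOn_f_node {i : ℕ} (hi : i ≤ r) :
    ContinuousOn (fun x : B => f x (α i x)) D := by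
  have h : ContinuousOn (fun x : B => (x, α i x)) D := continuousOn_id.prodMk (H.cont i)
  refine H.fcont.comp h fun x hx => ?_
  exact ⟨hx, H.mono x hx (Nat.zero_le i), H.mono x hx hi⟩

/-- Continuity of each contribution on `D × ℝ`. [cite: Pawlucki2024, Lemma 5.1] -/
theorem continuousOn_crContrib {i : ℕ} (hi : i < r) :
    ContinuousOn (fun p : B × ℝ => crContrib α f caseII μ i p.1 p.2) {p : B × ℝ | p.1 ∈ D} := by
  unfold crContrib
  by_cases hc : caseII i = true
  · simp only [hc, if_true]
    refine (((continuous_apply (μ i)).comp_continuousOn (H.continuousOn_f_clamp hi)).sub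
      ((continuous_apply (μ i)).comp_continuousOn
        ((H.continuousOn_f_node hi.le).comp continuousOn_fst fun p hp => hp))).abs
  · simp only [hc, Bool.false_eq_true, if_false]
    have h1 : ContinuousOn (fun p : B × ℝ => α i p.1) {p : B × ℝ | p.1 ∈ D} :=
      (H.cont i).comp continuousOn_fst fun p hp => hp
    have h2 : ContinuousOn (fun p : B × ℝ => α (i + 1) p.1) {p : B × ℝ | p.1 ∈ D} :=
      (H.cont (i + 1)).comp continuousOn_fst fun p hp => hp
    unfold crClamp
    exact (continuousOn_clamp h1 h2 continuousOn_snd).sub h1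

/-- **`η` is jointly continuous on `D × ℝ`.** [cite: Pawlucki2024, Lemma 5.1] -/
theorem continuousOn_crEta :
    ContinuousOn (fun p : B × ℝ => crEta α f caseII μ r p.1 p.2) {p : B × ℝ | p.1 ∈ D} := by
  unfold crEta
  refine ((H.cont 0).comp continuousOn_fst fun p hp => hp).add ?_
  refine continuousOn_finsetSum _ fun i hi => ?_
  exact H.continuousOn_crContrib (mem_range.1 hi)

/-- The new nodes are continuous on `D`. [cite: Pawlucki2024, Lemma 5.1] -/
theorem continuousOn_crBeta (i : ℕ) : ContinuousOn (crBeta α f caseII μ r i) D := by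
  unfold crBeta
  exact H.continuousOn_crEta.comp (continuousOn_id.prodMk (H.cont i)) fun x hx => hx

/-- The new nodes form a laminar (monotone) family. [cite: Pawlucki2024, Lemma 5.1] -/
theorem crBeta_monotone {x : B} (hx : x ∈ D) : Monotone fun j => crBeta α f caseII μ r j x :=
  fun _ _ hij => crBeta_mono (H.mono x hx) (H.weak hx) hij

/-! ### The fibrewise inverse `ψ` of `η` -/

/-- The fibre-preserving map `E(x, t) = (x, η(x, t))`. [cite: Pawlucki2024, proof of Lemma 5.1] -/
theorem continuousOn_etaMap :
    ContinuousOn (fun p : B × ℝ => (p.1, crEta α f caseII μ r p.1 p.2)) {p : B × ℝ | p.1 ∈ D} :=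
  continuousOn_fst.prodMk H.continuousOn_crEta

/-- `E` is injective on the total capsule. [cite: Pawlucki2024, proof of Lemma 5.1] -/
theorem injOn_etaMap :
    InjOn (fun p : B × ℝ => (p.1, crEta α f caseII μ r p.1 p.2)) (lamTotal D α r) := by
  rintro ⟨x, t⟩ hp ⟨x', t'⟩ hq h
  simp only [Prod.mk.injEq] at h
  obtain ⟨rfl, h⟩ := h
  simp only [Prod.mk.injEq, true_and]
  exact (H.eta_strictMonoOn hp.1).injOn ⟨hp.2.1, hp.2.2⟩ ⟨hq.2.1, hq.2.2⟩ h

/-- `E` maps the total capsule of `α` ONTO the total capsule of `β`. [cite: Pawlucki2024, proof of Lemma 5.1] -/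
theorem image_etaMap :
    (fun p : B × ℝ => (p.1, crEta α f caseII μ r p.1 p.2)) '' lamTotal D α r =
      lamTotal D (crBeta α f caseII μ r) r := by
  ext ⟨x, u⟩
  constructor
  · rintro ⟨⟨x', t⟩, hp, h⟩
    simp only [Prod.mk.injEq] at h
    obtain ⟨rfl, rfl⟩ := h
    exact ⟨hp.1, crEta_mem_Icc (H.mono _ hp.1) (H.weak hp.1) ⟨hp.2.1, hp.2.2⟩⟩
  · rintro ⟨hx, h0, hr⟩
    have hc : ContinuousOn (crEta α f caseII μ r x) (Icc (α 0 x) (α r x)) :=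
      H.continuousOn_crEta.comp (continuousOn_const.prodMk continuousOn_id) fun t _ => hx
    have hle : α 0 x ≤ α r x := H.mono x hx (Nat.zero_le r)
    obtain ⟨t, ht, htu⟩ := intermediate_value_Icc hle hc ⟨h0, hr⟩
    exact ⟨(x, t), ⟨hx, ht.1, ht.2⟩, by simp [htu]⟩

/-- The total capsule of `β` is compact. [cite: Pawlucki2024, proof of Lemma 5.1] -/
theorem isCompact_lamTotal_beta : IsCompact (lamTotal D (crBeta α f caseII μ r) r) := by
  rw [← H.image_etaMap]
  exact (isCompact_lamTotal H.compact H.cont H.mono r).image_of_continuousOn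
    (H.continuousOn_etaMap.mono fun p hp => hp.1)

end CRHyp

/-- **The fibrewise inverse `ψ(x, u)` of `η(x, ·)`** (second component of the partial inverse of
`E` on the total capsule). [cite: Pawlucki2024, proof of Lemma 5.1] -/
def crPsi [Nonempty B] (D : Set B) (α : ℕ → B → ℝ) (r : ℕ) (f : B → ℝ → Fin d → ℝ)
    (caseII : ℕ → Bool) (μ : ℕ → Fin d) (x : B) (u : ℝ) : ℝ :=
  (Function.invFunOn (fun p : B × ℝ => (p.1, crEta α f caseII μ r p.1 p.2)) (lamTotal D α r) (x, u)).2

namespace CRHyp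

variable [Nonempty B] (H : CRHyp D α r f caseII μ)
include H

/-- `(x, ψ(x,u))` lies in the total capsule and `η(x, ψ(x,u)) = u`, for `(x,u)` in the capsule of
`β`. [cite: Pawlucki2024, proof of Lemma 5.1] -/
theorem psi_spec {x : B} {u : ℝ} (hxu : (x, u) ∈ lamTotal D (crBeta α f caseII μ r) r) :
    (x, crPsi D α r f caseII μ x u) ∈ lamTotal D α r ∧
      crEta α f caseII μ r x (crPsi D α r f caseII μ x u) = u := by
  set E := fun p : B × ℝ => (p.1, crEta α f caseII μ r p.1 p.2) with hE
  have hmem : (x, u) ∈ E '' lamTotal D α r := by rw [H.image_etaMap]; exact hxu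
  have h1 : Function.invFunOn E (lamTotal D α r) (x, u) ∈ lamTotal D α r := Function.invFunOn_mem hmem
  have h2 : E (Function.invFunOn E (lamTotal D α r) (x, u)) = (x, u) := Function.invFunOn_eq hmem
  simp only [hE, Prod.mk.injEq] at h2
  have hfst : (Function.invFunOn E (lamTotal D α r) (x, u)).1 = x := h2.1
  constructor
  · have : (x, crPsi D α r f caseII μ x u) = Function.invFunOn E (lamTotal D α r) (x, u) := by
      ext
      · exact hfst.symm
      · rfl
    rw [this]; exact h1
  · have h := h2.2
    rw [hfst] at h
    exact h

/-- `ψ(x, η(x, t)) = t` on the total capsule. [cite: Pawlucki2024, proof of Lemma 5.1] -/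
theorem psi_eta {x : B} {t : ℝ} (hxt : (x, t) ∈ lamTotal D α r) :
    crPsi D α r f caseII μ x (crEta α f caseII μ r x t) = t := by
  have h := H.injOn_etaMap.leftInvOn_invFunOn hxt
  unfold crPsi
  rw [h]

/-- `η(x, ψ(x, u)) = u`. [cite: Pawlucki2024, proof of Lemma 5.1] -/
theorem eta_psi {x : B} {u : ℝ} (hxu : (x, u) ∈ lamTotal D (crBeta α f caseII μ r) r) :
    crEta α f caseII μ r x (crPsi D α r f caseII μ x u) = u :=
  (H.psi_spec hxu).2

/-- `ψ(x, u) ∈ [α₀(x), α_r(x)]`. [cite: Pawlucki2024, proof of Lemma 5.1] -/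
theorem psi_mem {x : B} {u : ℝ} (hxu : (x, u) ∈ lamTotal D (crBeta α f caseII μ r) r) :
    crPsi D α r f caseII μ x u ∈ Icc (α 0 x) (α r x) :=
  ⟨(H.psi_spec hxu).1.2.1, (H.psi_spec hxu).1.2.2⟩

/-- **`ψ` is jointly continuous on the total capsule of `β`** (compactness).
[cite: Pawlucki2024, proof of Lemma 5.1] -/
theorem continuousOn_crPsi [T2Space B] :
    ContinuousOn (fun q : B × ℝ => crPsi D α r f caseII μ q.1 q.2)
      (lamTotal D (crBeta α f caseII μ r) r) := by
  have h := continuousOn_invFunOn_of_isCompact_injOn (isCompact_lamTotal H.compact H.cont H.mono r)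
    (H.continuousOn_etaMap.mono fun p hp => hp.1) H.injOn_etaMap
  rw [H.image_etaMap] at h
  exact continuous_snd.comp_continuousOn h

/-- `ψ(x, ·)` is strictly increasing on `[β₀(x), β_r(x)]`. [cite: Pawlucki2024, proof of Lemma 5.1] -/
theorem psi_strictMonoOn {x : B} (hx : x ∈ D) :
    StrictMonoOn (crPsi D α r f caseII μ x)
      (Icc (crBeta α f caseII μ r 0 x) (crBeta α f caseII μ r r x)) := by
  intro u hu u' hu' huu'
  by_contra h
  have hle := le_of_not_gt h
  have h1 := H.eta_psi ⟨hx, hu.1, hu.2⟩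
  have h2 := H.eta_psi ⟨hx, hu'.1, hu'.2⟩
  have hmono := (H.eta_strictMonoOn hx).monotoneOn (H.psi_mem ⟨hx, hu'.1, hu'.2⟩)
    (H.psi_mem ⟨hx, hu.1, hu.2⟩) hle
  rw [h1, h2] at hmono
  exact absurd huu' (not_lt.2 hmono)

/-- `ψ` at the nodes: `ψ(x, β_i(x)) = α_i(x)`. [cite: Pawlucki2024, proof of Lemma 5.1] -/
theorem psi_beta {x : B} (hx : x ∈ D) {i : ℕ} (hi : i ≤ r) :
    crPsi D α r f caseII μ x (crBeta α f caseII μ r i x) = α i x :=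
  H.psi_eta ⟨hx, H.mono x hx (Nat.zero_le i), H.mono x hx hi⟩

/-- `ψ` maps the `i`-th piece of `β` into the `i`-th piece of `α`. [cite: Pawlucki2024, (5.1.4)] -/
theorem psi_mem_piece {x : B} (hx : x ∈ D) {i : ℕ} (hi : i < r) {u : ℝ}
    (hu : u ∈ Icc (crBeta α f caseII μ r i x) (crBeta α f caseII μ r (i + 1) x)) :
    crPsi D α r f caseII μ x u ∈ Icc (α i x) (α (i + 1) x) := by
  have hmono := (H.psi_strictMonoOn hx).monotoneOn
  have hβ := H.crBeta_monotone hx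
  have h0i : crBeta α f caseII μ r 0 x ≤ crBeta α f caseII μ r i x := hβ (Nat.zero_le i)
  have hir : crBeta α f caseII μ r (i + 1) x ≤ crBeta α f caseII μ r r x := hβ (Nat.succ_le_of_lt hi)
  have hu' : u ∈ Icc (crBeta α f caseII μ r 0 x) (crBeta α f caseII μ r r x) :=
    ⟨h0i.trans hu.1, hu.2.trans hir⟩
  constructor
  · rw [← H.psi_beta hx hi.le]
    exact hmono ⟨h0i, hu.1.trans hu'.2⟩ hu' hu.1
  · rw [← H.psi_beta hx (Nat.succ_le_of_lt hi)]
    exact hmono hu' ⟨hu'.1.trans hu.2, hir⟩ hu.2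

/-- `ψ` maps the open `i`-th piece of `β` into the open `i`-th piece of `α`. [cite: Pawlucki2024, (5.1.4)] -/
theorem psi_mem_openPiece {x : B} (hx : x ∈ D) {i : ℕ} (hi : i < r) {u : ℝ}
    (hu : u ∈ Ioo (crBeta α f caseII μ r i x) (crBeta α f caseII μ r (i + 1) x)) :
    crPsi D α r f caseII μ x u ∈ Ioo (α i x) (α (i + 1) x) := by
  have hstrict := H.psi_strictMonoOn hx
  have hβ := H.crBeta_monotone hx
  have h0i : crBeta α f caseII μ r 0 x ≤ crBeta α f caseII μ r i x := hβ (Nat.zero_le i)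
  have hir : crBeta α f caseII μ r (i + 1) x ≤ crBeta α f caseII μ r r x := hβ (Nat.succ_le_of_lt hi)
  have hu' : u ∈ Icc (crBeta α f caseII μ r 0 x) (crBeta α f caseII μ r r x) :=
    ⟨h0i.trans hu.1.le, hu.2.le.trans hir⟩
  constructor
  · rw [← H.psi_beta hx hi.le]
    exact hstrict ⟨h0i, hu.1.le.trans hu'.2⟩ hu' hu.1
  · rw [← H.psi_beta hx (Nat.succ_le_of_lt hi)]
    exact hstrict hu' ⟨hu'.1.trans hu.2.le, hir⟩ hu.2

end CRHyp

/-! ### Derivative hypotheses and the `t`-derivative of `ψ` -/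

/-- The full hypotheses of [Pawlucki2024, Lemma 5.1] for `p = 1` after the dichotomy refinement:
`g_ν = ∂_t f_ν` continuous on the open `K₁`-pieces, case I (`|g_ν| ≤ c`, (5.1.7)) or case II
(`c⁻¹ ≤ |g_μ|`, `|g_ν| ≤ c|g_μ|`, (5.1.8)–(5.1.9)) on each of them; `c ≥ 1`.
[cite: Pawlucki2024, Lemma 5.1, (5.1.7)–(5.1.9)] -/
structure CRDerivHyp (D : Set B) (α : ℕ → B → ℝ) (r : ℕ) (f : B → ℝ → Fin d → ℝ)
    (caseII : ℕ → Bool) (μ : ℕ → Fin d) (g : Fin d → B → ℝ → ℝ) (K1 : Set ℕ) (c : ℝ) : Prop where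
  compact : IsCompact D
  cont : ∀ j, ContinuousOn (α j) D
  mono : ∀ x ∈ D, Monotone fun j => α j x
  fcont : ContinuousOn (fun p : B × ℝ => f p.1 p.2) (lamTotal D α r)
  one_le : 1 ≤ c
  deriv : ∀ i ∈ K1, i < r → ∀ x ∈ D, ∀ t ∈ Ioo (α i x) (α (i + 1) x), ∀ ν,
    HasDerivAt (fun t => f x t ν) (g ν x t) t
  gcont : ∀ i ∈ K1, i < r → ∀ ν, ContinuousOn (fun p : B × ℝ => g ν p.1 p.2) (lamOpenPiece D α i)
  caseI_bound : ∀ i ∈ K1, i < r → caseII i = false → ∀ x ∈ D, ∀ t ∈ Ioo (α i x) (α (i + 1) x),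
    ∀ ν, |g ν x t| ≤ c
  caseII_mem : ∀ i < r, caseII i = true → i ∈ K1
  caseII_lower : ∀ i < r, caseII i = true → ∀ x ∈ D, ∀ t ∈ Ioo (α i x) (α (i + 1) x),
    c⁻¹ ≤ |g (μ i) x t|
  caseII_dom : ∀ i < r, caseII i = true → ∀ x ∈ D, ∀ t ∈ Ioo (α i x) (α (i + 1) x), ∀ ν,
    |g ν x t| ≤ c * |g (μ i) x t|

/-- A continuous nowhere vanishing function on an interval has constant sign. [folklore] -/
theorem forall_pos_or_forall_neg_of_continuousOn {φ : ℝ → ℝ} {a b : ℝ} (hc : ContinuousOn φ (Ioo a b))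
    (hne : ∀ t ∈ Ioo a b, φ t ≠ 0) : (∀ t ∈ Ioo a b, 0 < φ t) ∨ (∀ t ∈ Ioo a b, φ t < 0) := by
  by_contra h
  rw [not_or, not_forall, not_forall] at h
  obtain ⟨⟨t₀, ht₀⟩, ⟨t₁, ht₁⟩⟩ := h
  rw [Classical.not_imp, not_lt] at ht₀ ht₁
  have h0 : φ t₀ < 0 := lt_of_le_of_ne ht₀.2 (hne t₀ ht₀.1)
  have h1 : 0 < φ t₁ := lt_of_le_of_ne ht₁.2 (Ne.symm (hne t₁ ht₁.1))
  have hpc : IsPreconnected (Ioo a b) := isPreconnected_Ioo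
  obtain ⟨t, ht, hφt⟩ := hpc.intermediate_value₂ ht₀.1 ht₁.1 hc continuousOn_const h0.le h1.le
  exact hne t ht hφt

variable {g : Fin d → B → ℝ → ℝ} {K1 : Set ℕ} {c : ℝ}

namespace CRDerivHyp

variable (H : CRDerivHyp D α r f caseII μ g K1 c)
include H

/-- `c > 0`. [cite: Pawlucki2024, Lemma 5.1] -/
theorem c_pos : 0 < c := lt_of_lt_of_le one_pos H.one_le

/-- `f(x, ·)` is continuous on each fibre piece `[α_i(x), α_{i+1}(x)]`. [cite: Pawlucki2024, Lemma 5.1] -/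
theorem continuousOn_fibre {x : B} (hx : x ∈ D) {i : ℕ} (hi : i < r) (ν : Fin d) :
    ContinuousOn (fun t => f x t ν) (Icc (α i x) (α (i + 1) x)) := by
  have h := H.fcont.comp (continuousOn_const.prodMk continuousOn_id) fun t (ht : t ∈ Icc (α i x) (α (i + 1) x)) =>
    lamPiece_subset_lamTotal H.mono hi ⟨hx, ht.1, ht.2⟩
  exact (continuous_apply ν).comp_continuousOn h

/-- `g_μ(x, ·)` is continuous on the open fibre piece (case II pieces). [cite: Pawlucki2024, Lemma 5.1] -/
theorem continuousOn_g_fibre {x : B} (hx : x ∈ D) {i : ℕ} (hiK : i ∈ K1) (hi : i < r) (ν : Fin d) :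
    ContinuousOn (fun t => g ν x t) (Ioo (α i x) (α (i + 1) x)) :=
  (H.gcont i hiK hi ν).comp (continuousOn_const.prodMk continuousOn_id)
    fun t (ht : t ∈ Ioo (α i x) (α (i + 1) x)) => ⟨hx, ht.1, ht.2⟩

/-- **Sign dichotomy in case II**: along each fibre of a case II piece, either `g_μ > 0` and
`f_μ(x, ·)` is strictly increasing, or `g_μ < 0` and it is strictly decreasing.
[cite: Pawlucki2024, Lemma 5.1, (5.1.8)] -/
theorem caseII_sign {i : ℕ} (hi : i < r) (hc : caseII i = true) {x : B} (hx : x ∈ D) :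
    ((∀ t ∈ Ioo (α i x) (α (i + 1) x), 0 < g (μ i) x t) ∧
        StrictMonoOn (f x · (μ i)) (Icc (α i x) (α (i + 1) x))) ∨
      ((∀ t ∈ Ioo (α i x) (α (i + 1) x), g (μ i) x t < 0) ∧
        StrictAntiOn (f x · (μ i)) (Icc (α i x) (α (i + 1) x))) := by
  have hiK := H.caseII_mem i hi hc
  have hne : ∀ t ∈ Ioo (α i x) (α (i + 1) x), g (μ i) x t ≠ 0 := fun t ht h0 => by
    have h := H.caseII_lower i hi hc x hx t ht
    rw [h0, abs_zero] at h
    exact absurd h (not_le.2 (inv_pos.2 H.c_pos))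
  have hcf := H.continuousOn_fibre hx hi (μ i)
  have hderiv : ∀ t ∈ interior (Icc (α i x) (α (i + 1) x)), _root_.deriv (f x · (μ i)) t = g (μ i) x t := by
    intro t ht
    rw [interior_Icc] at ht
    exact (H.deriv i hiK hi x hx t ht (μ i)).deriv
  rcases forall_pos_or_forall_neg_of_continuousOn (H.continuousOn_g_fibre hx hiK hi (μ i)) hne with hpos | hneg
  · left
    refine ⟨hpos, strictMonoOn_of_deriv_pos (convex_Icc _ _) hcf fun t ht => ?_⟩
    rw [hderiv t ht]
    rw [interior_Icc] at ht
    exact hpos t ht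
  · right
    refine ⟨hneg, strictAntiOn_of_deriv_neg (convex_Icc _ _) hcf fun t ht => ?_⟩
    rw [hderiv t ht]
    rw [interior_Icc] at ht
    exact hneg t ht

/-- The derivative hypotheses imply the topological ones. [cite: Pawlucki2024, Lemma 5.1] -/
theorem toCRHyp : CRHyp D α r f caseII μ where
  compact := H.compact
  cont := H.cont
  mono := H.mono
  fcont := H.fcont
  strict := fun _ hi hc _ hx => (H.caseII_sign hi hc hx).imp And.right And.right

/-- In case I the new gap equals the old gap: `β_{i+1} - β_i = α_{i+1} - α_i`. [cite: Pawlucki2024, Lemma 5.1] -/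
theorem crBeta_succ_caseI {x : B} (hx : x ∈ D) {i : ℕ} (hi : i < r) (hc : caseII i = false) :
    crBeta α f caseII μ r (i + 1) x = crBeta α f caseII μ r i x + (α (i + 1) x - α i x) := by
  rw [crBeta_succ (H.mono x hx) hi]
  unfold crContrib
  rw [crClamp_of_mem ⟨H.mono x hx (Nat.le_succ i), le_rfl⟩]
  simp [hc]

/-- **`η` on a case I piece**: `η(x, t) = β_i(x) + (t - α_i(x))`. [cite: Pawlucki2024, Lemma 5.1, Case I] -/
theorem eta_caseI {x : B} (hx : x ∈ D) {i : ℕ} (hi : i < r) (hc : caseII i = false) {t : ℝ}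
    (ht : t ∈ Icc (α i x) (α (i + 1) x)) :
    crEta α f caseII μ r x t = crBeta α f caseII μ r i x + (t - α i x) := by
  rw [crEta_eq_of_mem (H.mono x hx) hi ht]
  unfold crContrib
  rw [crClamp_of_mem ht]
  simp [hc]

/-- **`η` on a case II piece**: `η(x, t) = β_i(x) + σ (f_μ(x,t) - f_μ(x,α_i(x)))` with `σ = 1` on
increasing fibres and `σ = -1` on decreasing ones. [cite: Pawlucki2024, Lemma 5.1, Case II] -/
theorem eta_caseII {x : B} (hx : x ∈ D) {i : ℕ} (hi : i < r) (hc : caseII i = true) :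
    ∃ σ : ℝ, (σ = 1 ∨ σ = -1) ∧ (∀ t ∈ Ioo (α i x) (α (i + 1) x), σ * g (μ i) x t = |g (μ i) x t|) ∧
      ∀ t ∈ Icc (α i x) (α (i + 1) x), crEta α f caseII μ r x t =
        crBeta α f caseII μ r i x + σ * (f x t (μ i) - f x (α i x) (μ i)) := by
  have hαle : α i x ≤ α (i + 1) x := H.mono x hx (Nat.le_succ i)
  rcases H.caseII_sign hi hc hx with ⟨hpos, hmono⟩ | ⟨hneg, hanti⟩
  · refine ⟨1, Or.inl rfl, fun t ht => ?_, fun t ht => ?_⟩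
    · rw [one_mul, abs_of_pos (hpos t ht)]
    · rw [crEta_eq_of_mem (H.mono x hx) hi ht]
      unfold crContrib
      rw [crClamp_of_mem ht, if_pos hc, one_mul, abs_of_nonneg]
      exact sub_nonneg.2 (hmono.monotoneOn ⟨le_rfl, hαle⟩ ht ht.1)
  · refine ⟨-1, Or.inr rfl, fun t ht => ?_, fun t ht => ?_⟩
    · rw [neg_one_mul, abs_of_neg (hneg t ht)]
    · rw [crEta_eq_of_mem (H.mono x hx) hi ht]
      unfold crContrib
      rw [crClamp_of_mem ht, if_pos hc, neg_one_mul,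
        abs_of_nonpos (sub_nonpos.2 (hanti.antitoneOn ⟨le_rfl, hαle⟩ ht ht.1))]

/-- Derivative of `η(x, ·)` inside a case II piece: `|g_μ|`. [cite: Pawlucki2024, Lemma 5.1, Case II] -/
theorem hasDerivAt_eta_caseII {x : B} (hx : x ∈ D) {i : ℕ} (hi : i < r) (hc : caseII i = true) {t : ℝ}
    (ht : t ∈ Ioo (α i x) (α (i + 1) x)) :
    HasDerivAt (crEta α f caseII μ r x) (|g (μ i) x t|) t := by
  obtain ⟨σ, -, hσg, hform⟩ := H.eta_caseII hx hi hc
  have hiK := H.caseII_mem i hi hc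
  have hd : HasDerivAt (fun t => crBeta α f caseII μ r i x + σ * (f x t (μ i) - f x (α i x) (μ i)))
      (σ * g (μ i) x t) t := by
    have h := ((H.deriv i hiK hi x hx t ht (μ i)).sub_const (f x (α i x) (μ i))).const_mul σ
    simpa using h.const_add (crBeta α f caseII μ r i x)
  rw [← hσg t ht]
  refine hd.congr_of_eventuallyEq ?_
  filter_upwards [Ioo_mem_nhds ht.1 ht.2] with t' ht'
  exact hform t' ⟨ht'.1.le, ht'.2.le⟩

end CRDerivHyp

/-- The zero-one selector of the open case II piece containing `(x, u)` (at most one).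
[cite: Pawlucki2024, proof of Lemma 5.1] -/
def crInd (α : ℕ → B → ℝ) (f : B → ℝ → Fin d → ℝ) (caseII : ℕ → Bool) (μ : ℕ → Fin d) (r : ℕ)
    (i : ℕ) (x : B) (u : ℝ) : Prop :=
  caseII i = true ∧ crBeta α f caseII μ r i x < u ∧ u < crBeta α f caseII μ r (i + 1) x

/-- **The `u`-derivative of `ψ(x, ·)`** on the open pieces: `1` on case I pieces (and by
convention elsewhere), `|g_μ(x, ψ(x,u))|⁻¹` on the open case II pieces.
[cite: Pawlucki2024, proof of Lemma 5.1, "0 < ∂ψ/∂η ≤ max(1,c)"] -/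
def crPsiD [Nonempty B] (D : Set B) (α : ℕ → B → ℝ) (r : ℕ) (f : B → ℝ → Fin d → ℝ)
    (caseII : ℕ → Bool) (μ : ℕ → Fin d) (g : Fin d → B → ℝ → ℝ) (x : B) (u : ℝ) : ℝ := by
  classical
  exact if h : ∃ i < r, crInd α f caseII μ r i x u then
    |g (μ (Nat.find h)) x (crPsi D α r f caseII μ x u)|⁻¹ else 1

namespace CRDerivHyp

variable [Nonempty B] (H : CRDerivHyp D α r f caseII μ g K1 c)
include H

omit [Nonempty B] in
/-- Open pieces of `β` are disjoint. [cite: Pawlucki2024, Lemma 5.1] -/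
theorem eq_of_mem_openPiece_beta {x : B} (hx : x ∈ D) {i j : ℕ} {u : ℝ}
    (hui : u ∈ Ioo (crBeta α f caseII μ r i x) (crBeta α f caseII μ r (i + 1) x))
    (huj : u ∈ Ioo (crBeta α f caseII μ r j x) (crBeta α f caseII μ r (j + 1) x)) : i = j := by
  have hβ := H.toCRHyp.crBeta_monotone hx
  by_contra hne
  rcases lt_or_gt_of_ne hne with h | h
  · exact absurd (hui.2.trans_le ((hβ (Nat.succ_le_of_lt h)).trans huj.1.le)) (lt_irrefl u)
  · exact absurd (huj.2.trans_le ((hβ (Nat.succ_le_of_lt h)).trans hui.1.le)) (lt_irrefl u)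

/-- Value of `ψ'` on an open case II piece. [cite: Pawlucki2024, proof of Lemma 5.1] -/
theorem crPsiD_of_caseII {x : B} (hx : x ∈ D) {i : ℕ} (hi : i < r) (hc : caseII i = true) {u : ℝ}
    (hu : u ∈ Ioo (crBeta α f caseII μ r i x) (crBeta α f caseII μ r (i + 1) x)) :
    crPsiD D α r f caseII μ g x u = |g (μ i) x (crPsi D α r f caseII μ x u)|⁻¹ := by
  classical
  have hex : ∃ j < r, crInd α f caseII μ r j x u := ⟨i, hi, hc, hu.1, hu.2⟩
  unfold crPsiD
  rw [dif_pos hex]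
  obtain ⟨hj, hcj, hu1, hu2⟩ := Nat.find_spec hex
  have heq : Nat.find hex = i := H.eq_of_mem_openPiece_beta hx ⟨hu1, hu2⟩ hu
  rw [heq]

/-- Value of `ψ'` on an open case I piece: `1`. [cite: Pawlucki2024, proof of Lemma 5.1] -/
theorem crPsiD_of_caseI {x : B} (hx : x ∈ D) {i : ℕ} (hc : caseII i = false) {u : ℝ}
    (hu : u ∈ Ioo (crBeta α f caseII μ r i x) (crBeta α f caseII μ r (i + 1) x)) :
    crPsiD D α r f caseII μ g x u = 1 := by
  classical
  have hnex : ¬ ∃ j < r, crInd α f caseII μ r j x u := by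
    rintro ⟨j, hj, hcj, hu1, hu2⟩
    have heq := H.eq_of_mem_openPiece_beta hx ⟨hu1, hu2⟩ hu
    rw [heq, hc] at hcj
    exact Bool.false_ne_true hcj
  unfold crPsiD
  rw [dif_neg hnex]

/-- **`ψ` on a case I piece**: `ψ(x, u) = α_i(x) + (u - β_i(x))`. [cite: Pawlucki2024, Lemma 5.1, Case I] -/
theorem psi_caseI {x : B} (hx : x ∈ D) {i : ℕ} (hi : i < r) (hc : caseII i = false) {u : ℝ}
    (hu : u ∈ Icc (crBeta α f caseII μ r i x) (crBeta α f caseII μ r (i + 1) x)) :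
    crPsi D α r f caseII μ x u = α i x + (u - crBeta α f caseII μ r i x) := by
  set t := α i x + (u - crBeta α f caseII μ r i x) with ht_def
  have hgap := H.crBeta_succ_caseI hx hi hc
  have ht : t ∈ Icc (α i x) (α (i + 1) x) := ⟨by rw [ht_def]; linarith [hu.1], by rw [ht_def]; linarith [hu.2]⟩
  have hη : crEta α f caseII μ r x t = u := by
    rw [H.eta_caseI hx hi hc ht, ht_def]; ring
  rw [← hη]
  exact H.toCRHyp.psi_eta (lamPiece_subset_lamTotal H.mono hi ⟨hx, ht.1, ht.2⟩)

/-- **`f_μ ∘ ψ` on a case II piece**: `f_μ(x, ψ(x,u)) = f_μ(x, α_i(x)) + σ (u - β_i(x))`, with the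
sign `σ = ±1` of the fibre (and `σ g_μ = |g_μ|`). [cite: Pawlucki2024, Lemma 5.1, Case II] -/
theorem f_psi_caseII {x : B} (hx : x ∈ D) {i : ℕ} (hi : i < r) (hc : caseII i = true) :
    ∃ σ : ℝ, (σ = 1 ∨ σ = -1) ∧ (∀ t ∈ Ioo (α i x) (α (i + 1) x), σ * g (μ i) x t = |g (μ i) x t|) ∧
      ∀ u ∈ Icc (crBeta α f caseII μ r i x) (crBeta α f caseII μ r (i + 1) x),
        f x (crPsi D α r f caseII μ x u) (μ i) = f x (α i x) (μ i) + σ * (u - crBeta α f caseII μ r i x) := by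
  obtain ⟨σ, hσ, hσg, hform⟩ := H.eta_caseII hx hi hc
  refine ⟨σ, hσ, hσg, fun u hu => ?_⟩
  have hβ := H.toCRHyp.crBeta_monotone hx
  have hu' : (x, u) ∈ lamTotal D (crBeta α f caseII μ r) r :=
    ⟨hx, (hβ (Nat.zero_le i)).trans hu.1, hu.2.trans (hβ (Nat.succ_le_of_lt hi))⟩
  have hψ := H.toCRHyp.psi_mem_piece hx hi hu
  have hη := H.toCRHyp.eta_psi hu'
  rw [hform _ hψ] at hη
  have hσ2 : σ * σ = 1 := by rcases hσ with rfl | rfl <;> norm_num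
  have h1 : σ * (f x (crPsi D α r f caseII μ x u) (μ i) - f x (α i x) (μ i)) =
      u - crBeta α f caseII μ r i x := by linarith [hη]
  have h2 : f x (crPsi D α r f caseII μ x u) (μ i) - f x (α i x) (μ i) =
      σ * (u - crBeta α f caseII μ r i x) := by
    have h3 : σ * (σ * (f x (crPsi D α r f caseII μ x u) (μ i) - f x (α i x) (μ i))) =
        σ * (u - crBeta α f caseII μ r i x) := by rw [h1]
    rw [← mul_assoc, hσ2, one_mul] at h3
    exact h3
  linarith [h2]

/-- **Derivative of `ψ(x, ·)` on an open case I piece: `1`.** [cite: Pawlucki2024, Lemma 5.1] -/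
theorem hasDerivAt_psi_caseI [T2Space B] {x : B} (hx : x ∈ D) {i : ℕ} (hi : i < r)
    (hc : caseII i = false) {u : ℝ}
    (hu : u ∈ Ioo (crBeta α f caseII μ r i x) (crBeta α f caseII μ r (i + 1) x)) :
    HasDerivAt (crPsi D α r f caseII μ x) (crPsiD D α r f caseII μ g x u) u := by
  rw [H.crPsiD_of_caseI hx hc hu]
  have hd : HasDerivAt (fun u => α i x + (u - crBeta α f caseII μ r i x)) 1 u := by
    simpa using ((hasDerivAt_id u).sub_const (crBeta α f caseII μ r i x)).const_add (α i x)
  refine hd.congr_of_eventuallyEq ?_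
  filter_upwards [Ioo_mem_nhds hu.1 hu.2] with u' hu'
  exact H.psi_caseI hx hi hc ⟨hu'.1.le, hu'.2.le⟩

/-- **Derivative of `ψ(x, ·)` on an open case II piece: `|g_μ(x, ψ)|⁻¹`** (inverse function rule).
[cite: Pawlucki2024, Lemma 5.1, "0 < ∂ψ/∂η = 1/(∂η/∂x_n) ≤ c"] -/
theorem hasDerivAt_psi_caseII [T2Space B] {x : B} (hx : x ∈ D) {i : ℕ} (hi : i < r)
    (hc : caseII i = true) {u : ℝ}
    (hu : u ∈ Ioo (crBeta α f caseII μ r i x) (crBeta α f caseII μ r (i + 1) x)) :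
    HasDerivAt (crPsi D α r f caseII μ x) (crPsiD D α r f caseII μ g x u) u := by
  rw [H.crPsiD_of_caseII hx hi hc hu]
  have hβ := H.toCRHyp.crBeta_monotone hx
  have h0i := hβ (Nat.zero_le i)
  have hir := hβ (Nat.succ_le_of_lt hi)
  have hψ := H.toCRHyp.psi_mem_openPiece hx hi hu
  -- continuity of `ψ(x, ·)` at `u`
  have hcont : ContinuousAt (crPsi D α r f caseII μ x) u := by
    have hc2 : ContinuousOn (crPsi D α r f caseII μ x)
        (Icc (crBeta α f caseII μ r 0 x) (crBeta α f caseII μ r r x)) :=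
      H.toCRHyp.continuousOn_crPsi.comp (continuousOn_const.prodMk continuousOn_id)
        fun u' (hu' : u' ∈ Set.Icc _ _) => ⟨hx, hu'.1, hu'.2⟩
    exact hc2.continuousAt (Icc_mem_nhds (h0i.trans_lt hu.1) (hu.2.trans_le hir))
  have hne : |g (μ i) x (crPsi D α r f caseII μ x u)| ≠ 0 := by
    have h := H.caseII_lower i hi hc x hx _ hψ
    exact (lt_of_lt_of_le (inv_pos.2 H.c_pos) h).ne'
  refine HasDerivAt.of_local_left_inverse hcont (H.hasDerivAt_eta_caseII hx hi hc hψ) hne ?_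
  filter_upwards [Ioo_mem_nhds hu.1 hu.2] with u' hu'
  exact H.toCRHyp.eta_psi ⟨hx, h0i.trans hu'.1.le, hu'.2.le.trans hir⟩

/-- **Derivative of `ψ(x, ·)` on every open piece** (`i < r`). [cite: Pawlucki2024, Lemma 5.1] -/
theorem hasDerivAt_psi [T2Space B] {x : B} (hx : x ∈ D) {i : ℕ} (hi : i < r) {u : ℝ}
    (hu : u ∈ Ioo (crBeta α f caseII μ r i x) (crBeta α f caseII μ r (i + 1) x)) :
    HasDerivAt (crPsi D α r f caseII μ x) (crPsiD D α r f caseII μ g x u) u := by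
  by_cases hc : caseII i = true
  · exact H.hasDerivAt_psi_caseII hx hi hc hu
  · exact H.hasDerivAt_psi_caseI hx hi (Bool.eq_false_iff.2 hc) hu

/-- `0 < ψ' ≤ c` on the open pieces. [cite: Pawlucki2024, Lemma 5.1] -/
theorem crPsiD_pos_le {x : B} (hx : x ∈ D) {i : ℕ} (hi : i < r) {u : ℝ}
    (hu : u ∈ Ioo (crBeta α f caseII μ r i x) (crBeta α f caseII μ r (i + 1) x)) :
    0 < crPsiD D α r f caseII μ g x u ∧ crPsiD D α r f caseII μ g x u ≤ c := by
  by_cases hc : caseII i = true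
  · rw [H.crPsiD_of_caseII hx hi hc hu]
    have hψ := H.toCRHyp.psi_mem_openPiece hx hi hu
    have h := H.caseII_lower i hi hc x hx _ hψ
    have hcpos := H.c_pos
    have hgpos : 0 < |g (μ i) x (crPsi D α r f caseII μ x u)| := lt_of_lt_of_le (inv_pos.2 hcpos) h
    exact ⟨inv_pos.2 hgpos, by simpa using inv_anti₀ (inv_pos.2 hcpos) h⟩
  · rw [H.crPsiD_of_caseI hx (Bool.eq_false_iff.2 hc) hu]
    exact ⟨one_pos, H.one_le⟩

/-- **Joint continuity of `ψ'` on each open piece of `β`.** [cite: Pawlucki2024, Lemma 5.1] -/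
theorem continuousOn_crPsiD [T2Space B] {i : ℕ} (hi : i < r) :
    ContinuousOn (fun q : B × ℝ => crPsiD D α r f caseII μ g q.1 q.2)
      (lamOpenPiece D (crBeta α f caseII μ r) i) := by
  by_cases hc : caseII i = true
  · have hiK := H.caseII_mem i hi hc
    -- `q ↦ (q.1, ψ q)` maps the open `β`-piece into the open `α`-piece, continuously
    have hmap : ContinuousOn (fun q : B × ℝ => (q.1, crPsi D α r f caseII μ q.1 q.2))
        (lamOpenPiece D (crBeta α f caseII μ r) i) := by
      refine continuousOn_fst.prodMk (H.toCRHyp.continuousOn_crPsi.mono fun q hq => ?_)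
      have hβ := H.toCRHyp.crBeta_monotone hq.1
      exact ⟨hq.1, (hβ (Nat.zero_le i)).trans hq.2.1.le, hq.2.2.le.trans (hβ (Nat.succ_le_of_lt hi))⟩
    have hmaps : MapsTo (fun q : B × ℝ => (q.1, crPsi D α r f caseII μ q.1 q.2))
        (lamOpenPiece D (crBeta α f caseII μ r) i) (lamOpenPiece D α i) := fun q hq =>
      ⟨hq.1, H.toCRHyp.psi_mem_openPiece hq.1 hi ⟨hq.2.1, hq.2.2⟩⟩
    have hg := ((H.gcont i hiK hi (μ i)).comp hmap hmaps).abs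
    refine (hg.inv₀ fun q hq => ?_).congr fun q hq => H.crPsiD_of_caseII hq.1 hi hc ⟨hq.2.1, hq.2.2⟩
    have hψ := H.toCRHyp.psi_mem_openPiece hq.1 hi ⟨hq.2.1, hq.2.2⟩
    have h := H.caseII_lower i hi hc q.1 hq.1 _ hψ
    exact (lt_of_lt_of_le (inv_pos.2 H.c_pos) h).ne'
  · refine (continuousOn_const (c := (1 : ℝ))).congr fun q hq => ?_
    exact H.crPsiD_of_caseI hq.1 (Bool.eq_false_iff.2 hc) ⟨hq.2.1, hq.2.2⟩

end CRDerivHyp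

/-! ### Transfer between `D × ℝ ⊆ B × ℝ` and `↥D × ℝ` -/

/-- Continuity on a subset of `D × ℝ` from continuity of the pull-back to `↥D × ℝ` (the map
`Subtype.val × id` is inducing). [folklore] -/
theorem continuousOn_of_subtype_prod {Y : Type*} [TopologicalSpace Y] {D : Set B} {G : B × ℝ → Y}
    {S : Set (B × ℝ)} (hS : S ⊆ {p | p.1 ∈ D})
    (h : ContinuousOn (fun q : ↥D × ℝ => G ((q.1 : B), q.2)) {q | ((q.1 : B), q.2) ∈ S}) :
    ContinuousOn G S := by
  have hind : Topology.IsInducing (Prod.map ((↑) : ↥D → B) (id : ℝ → ℝ)) :=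
    Topology.IsInducing.subtypeVal.prodMap Topology.IsInducing.id
  have himage : Prod.map ((↑) : ↥D → B) (id : ℝ → ℝ) '' {q : ↥D × ℝ | ((q.1 : B), q.2) ∈ S} = S := by
    ext p
    constructor
    · rintro ⟨q, hq, rfl⟩; exact hq
    · intro hp
      exact ⟨(⟨p.1, hS hp⟩, p.2), hp, rfl⟩
  rw [← himage, hind.continuousOn_image_iff]
  exact h

/-- Continuity of the pull-back to `↥D × ℝ` from continuity on a subset of `D × ℝ`. [folklore] -/
theorem continuousOn_subtype_prod {Y : Type*} [TopologicalSpace Y] {D : Set B} {G : B × ℝ → Y}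
    {S : Set (B × ℝ)} (h : ContinuousOn G S) :
    ContinuousOn (fun q : ↥D × ℝ => G ((q.1 : B), q.2)) {q | ((q.1 : B), q.2) ∈ S} :=
  h.comp ((continuous_subtype_val.prodMap continuous_id).continuousOn) fun _ hq => hq

/-! ### The flat fibre map `φ = ψ ∘ ω` -/

/-- The source nodes `δ_i(x) = κ_i(β(x))`. [cite: Pawlucki2024, Lemma 5.1, (5.1.3)] -/
def crDelta (α : ℕ → B → ℝ) (f : B → ℝ → Fin d → ℝ) (caseII : ℕ → Bool) (μ : ℕ → Fin d) (r : ℕ)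
    (i : ℕ) (x : B) : ℝ :=
  frNode (fun j => crBeta α f caseII μ r j x) i

/-- The flat reparametrization through the nodes `β(x)`: `ω_x(s)`. [cite: Pawlucki2024, Lemma 5.1] -/
def crOmg (α : ℕ → B → ℝ) (f : B → ℝ → Fin d → ℝ) (caseII : ℕ → Bool) (μ : ℕ → Fin d) (r : ℕ)
    (x : B) (s : ℝ) : ℝ :=
  frOmega (fun j => crBeta α f caseII μ r j x) r s

/-- Its `s`-derivative `ω'_x(s)`. [cite: Pawlucki2024, Lemma 5.1] -/
def crOmgD (α : ℕ → B → ℝ) (f : B → ℝ → Fin d → ℝ) (caseII : ℕ → Bool) (μ : ℕ → Fin d) (r : ℕ)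
    (x : B) (s : ℝ) : ℝ :=
  frOmegaD (fun j => crBeta α f caseII μ r j x) r s

/-- **The fibre map `φ(x, s) = ψ(x, ω_x(s))`** of [Pawlucki2024, Lemma 5.1] (`p = 1`):
`Φ(x, s) = (x, φ(x, s))`. [cite: Pawlucki2024, Lemma 5.1, (5.1.1)] -/
def crPhi [Nonempty B] (D : Set B) (α : ℕ → B → ℝ) (r : ℕ) (f : B → ℝ → Fin d → ℝ)
    (caseII : ℕ → Bool) (μ : ℕ → Fin d) (x : B) (s : ℝ) : ℝ :=
  crPsi D α r f caseII μ x (crOmg α f caseII μ r x s)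

/-- **Its `s`-derivative** `φ'(x, s) = ω'_x(s) ψ'(x, ω_x(s))` (zero at the nodes).
[cite: Pawlucki2024, Lemma 5.1, (5.1.2)] -/
def crPhiD [Nonempty B] (D : Set B) (α : ℕ → B → ℝ) (r : ℕ) (f : B → ℝ → Fin d → ℝ)
    (caseII : ℕ → Bool) (μ : ℕ → Fin d) (g : Fin d → B → ℝ → ℝ) (x : B) (s : ℝ) : ℝ :=
  crOmgD α f caseII μ r x s * crPsiD D α r f caseII μ g x (crOmg α f caseII μ r x s)

/-- `ω'` is positive inside the pieces. [cite: Pawlucki2024, Cor. 4.5] -/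
theorem frOmegaD_pos {y : ℕ → ℝ} {r i : ℕ} (hi : i < r) {s : ℝ}
    (hs : s ∈ Ioo (frNode y i) (frNode y (i + 1))) : 0 < frOmegaD y r s := by
  rw [frOmegaD_eq_term hi ⟨hs.1.le, hs.2.le⟩]
  have hW : 0 < frW y i := frW_pos_of_lt hs.1.le hs.2
  refine mul_pos hW (deriv_smoothstep_pos ⟨div_pos (sub_pos.2 hs.1) hW, ?_⟩)
  rw [div_lt_one hW, frNode_succ] at *
  linarith [hs.2]

namespace CRDerivHyp

variable [Nonempty B] [T2Space B] (H : CRDerivHyp D α r f caseII μ g K1 c)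
include H

/-- `ψ(x, ·)` is continuous on `[β₀(x), β_r(x)]`. [cite: Pawlucki2024, Lemma 5.1] -/
theorem continuousOn_psi_fibre {x : B} (hx : x ∈ D) :
    ContinuousOn (crPsi D α r f caseII μ x)
      (Icc (crBeta α f caseII μ r 0 x) (crBeta α f caseII μ r r x)) :=
  H.toCRHyp.continuousOn_crPsi.comp (continuousOn_const.prodMk continuousOn_id)
    fun u (hu : u ∈ Set.Icc _ _) => ⟨hx, hu.1, hu.2⟩

/-- **`φ(x, ·)` is differentiable everywhere**, with derivative `φ'(x, ·)`. [cite: Pawlucki2024, (5.1.2)] -/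
theorem hasDerivAt_crPhi {x : B} (hx : x ∈ D) (s : ℝ) :
    HasDerivAt (crPhi D α r f caseII μ x) (crPhiD D α r f caseII μ g x s) s := by
  have h := hasDerivAt_comp_frOmega (H.toCRHyp.crBeta_monotone hx) (r := r)
    (θ := crPsi D α r f caseII μ x) (θ' := crPsiD D α r f caseII μ g x) (L := c)
    (H.continuousOn_psi_fibre hx) (fun j hj t ht => H.hasDerivAt_psi hx hj ht)
    (fun j hj t ht => ?_) s
  · have h' : HasDerivAt (fun s => crPhi D α r f caseII μ x s) (crPhiD D α r f caseII μ g x s) s := by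
      unfold crPhi crPhiD crOmg crOmgD
      simpa only [smul_eq_mul] using h
    exact h'
  · rw [Real.norm_eq_abs, abs_of_pos (H.crPsiD_pos_le hx hj ht).1]
    exact (H.crPsiD_pos_le hx hj ht).2

omit [TopologicalSpace B] [T2Space B] H in
/-- `φ'` vanishes at every node `δ_i(x)`. [cite: Pawlucki2024, (5.1.2)] -/
theorem crPhiD_delta (x : B) (i : ℕ) :
    crPhiD D α r f caseII μ g x (crDelta α f caseII μ r i x) = 0 := by
  unfold crPhiD crOmgD crDelta
  rw [frOmegaD_node, zero_mul]

omit [Nonempty B] [T2Space B] in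
/-- `ω_x` maps `[0, δ_r(x)]`-pieces into `β`-pieces. [cite: Pawlucki2024, (5.1.4)] -/
theorem crOmg_mem_piece {x : B} (hx : x ∈ D) {i : ℕ} (hi : i < r) {s : ℝ}
    (hs : s ∈ Icc (crDelta α f caseII μ r i x) (crDelta α f caseII μ r (i + 1) x)) :
    crOmg α f caseII μ r x s ∈ Icc (crBeta α f caseII μ r i x) (crBeta α f caseII μ r (i + 1) x) := by
  have hβm := H.toCRHyp.crBeta_monotone hx
  unfold crOmg
  constructor
  · rw [← frOmega_node hβm hi.le]; exact frOmega_mono hβm r hs.1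
  · rw [← frOmega_node hβm (Nat.succ_le_of_lt hi)]; exact frOmega_mono hβm r hs.2

omit [T2Space B] in
/-- `φ(x, δ_i(x)) = α_i(x)`: the source nodes are mapped to the original nodes.
[cite: Pawlucki2024, Lemma 5.1, (5.1.3)] -/
theorem crPhi_delta {x : B} (hx : x ∈ D) {i : ℕ} (hi : i ≤ r) :
    crPhi D α r f caseII μ x (crDelta α f caseII μ r i x) = α i x := by
  unfold crPhi crOmg crDelta
  rw [frOmega_node (H.toCRHyp.crBeta_monotone hx) hi]
  exact H.toCRHyp.psi_beta hx hi

omit [T2Space B] in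
/-- `φ(x, ·)` maps the `i`-th source piece into the `i`-th target piece. [cite: Pawlucki2024, (5.1.4)] -/
theorem crPhi_mem_piece {x : B} (hx : x ∈ D) {i : ℕ} (hi : i < r) {s : ℝ}
    (hs : s ∈ Icc (crDelta α f caseII μ r i x) (crDelta α f caseII μ r (i + 1) x)) :
    crPhi D α r f caseII μ x s ∈ Icc (α i x) (α (i + 1) x) :=
  H.toCRHyp.psi_mem_piece hx hi (H.crOmg_mem_piece hx hi hs)

omit [T2Space B] in
/-- `φ(x, ·)` maps the open `i`-th source piece into the open `i`-th target piece.
[cite: Pawlucki2024, (5.1.4)] -/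
theorem crPhi_mem_openPiece {x : B} (hx : x ∈ D) {i : ℕ} (hi : i < r) {s : ℝ}
    (hs : s ∈ Ioo (crDelta α f caseII μ r i x) (crDelta α f caseII μ r (i + 1) x)) :
    crPhi D α r f caseII μ x s ∈ Ioo (α i x) (α (i + 1) x) :=
  H.toCRHyp.psi_mem_openPiece hx hi (frOmega_mem_Ioo (H.toCRHyp.crBeta_monotone hx) hi hs)

omit [T2Space B] in
/-- `φ(x, s) ∈ [α₀(x), α_r(x)]` for all `s`. [cite: Pawlucki2024, Lemma 5.1] -/
theorem crPhi_mem (x : B) (hx : x ∈ D) (s : ℝ) : crPhi D α r f caseII μ x s ∈ Icc (α 0 x) (α r x) := by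
  have h := frOmega_mem_Icc (H.toCRHyp.crBeta_monotone hx) r s
  exact H.toCRHyp.psi_mem ⟨hx, h.1, h.2⟩

omit [T2Space B] in
/-- **`φ(x, ·)` is strictly increasing on `[0, δ_r(x)]`.** [cite: Pawlucki2024, Lemma 5.1] -/
theorem crPhi_strictMonoOn {x : B} (hx : x ∈ D) :
    StrictMonoOn (crPhi D α r f caseII μ x) (Icc 0 (crDelta α f caseII μ r r x)) := by
  have hβm := H.toCRHyp.crBeta_monotone hx
  refine (H.toCRHyp.psi_strictMonoOn hx).comp (strictMonoOn_frOmega hβm r) fun s _ => ?_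
  exact frOmega_mem_Icc hβm r s

omit [T2Space B] in
/-- `φ'` is nonnegative, and positive inside the pieces. [cite: Pawlucki2024, (5.1.2), (8.1.9)] -/
theorem crPhiD_pos {x : B} (hx : x ∈ D) {i : ℕ} (hi : i < r) {s : ℝ}
    (hs : s ∈ Ioo (crDelta α f caseII μ r i x) (crDelta α f caseII μ r (i + 1) x)) :
    0 < crPhiD D α r f caseII μ g x s := by
  have hβm := H.toCRHyp.crBeta_monotone hx
  unfold crPhiD crOmgD
  exact mul_pos (frOmegaD_pos hi hs) (H.crPsiD_pos_le hx hi (frOmega_mem_Ioo hβm hi hs)).1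

omit [T2Space B] in
/-- `φ' ≥ 0` everywhere over `D`. [cite: Pawlucki2024, (5.1.2)] -/
theorem crPhiD_nonneg {x : B} (hx : x ∈ D) (s : ℝ) : 0 ≤ crPhiD D α r f caseII μ g x s := by
  by_cases h : ∃ i < r, crDelta α f caseII μ r i x < s ∧ s < crDelta α f caseII μ r (i + 1) x
  · obtain ⟨i, hi, hs⟩ := h
    exact (H.crPhiD_pos hx hi hs).le
  · unfold crPhiD crOmgD
    rw [frOmegaD_eq_zero_of_forall fun i hi hs => h ⟨i, hi, hs⟩, zero_mul]

/-- The union of the open pieces of `β`, pulled back to `↥D × ℝ`, supports `ψ'` continuously.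
[cite: Pawlucki2024, Lemma 5.1] -/
theorem continuousOn_crPsiD_union :
    ContinuousOn (fun q : ↥D × ℝ => crPsiD D α r f caseII μ g (q.1 : B) q.2)
      {q : ↥D × ℝ | ∃ j < r, crBeta α f caseII μ r j (q.1 : B) < q.2 ∧
        q.2 < crBeta α f caseII μ r (j + 1) (q.1 : B)} := by
  intro q hq
  obtain ⟨j, hj, hq1, hq2⟩ := hq
  have hYc : ∀ i, Continuous fun x : ↥D => crBeta α f caseII μ r i (x : B) := fun i =>
    (H.toCRHyp.continuousOn_crBeta i).restrict
  have hopen : IsOpen {q : ↥D × ℝ | crBeta α f caseII μ r j (q.1 : B) < q.2 ∧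
      q.2 < crBeta α f caseII μ r (j + 1) (q.1 : B)} :=
    (isOpen_lt ((hYc j).comp continuous_fst) continuous_snd).inter
      (isOpen_lt continuous_snd ((hYc (j + 1)).comp continuous_fst))
  have hcont : ContinuousOn (fun q : ↥D × ℝ => crPsiD D α r f caseII μ g (q.1 : B) q.2)
      {q : ↥D × ℝ | crBeta α f caseII μ r j (q.1 : B) < q.2 ∧
        q.2 < crBeta α f caseII μ r (j + 1) (q.1 : B)} := by
    have h := continuousOn_subtype_prod (D := D) (H.continuousOn_crPsiD hj)
    refine h.mono fun q hq => ?_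
    exact ⟨q.1.2, hq.1, hq.2⟩
  exact (hcont.continuousAt (hopen.mem_nhds ⟨hq1, hq2⟩)).continuousWithinAt

/-- **`φ'` is jointly continuous on `D × ℝ`** — it is the continuous extension by zero (to all
nodes, pinch points and the outside) of the `s`-derivative on the open pieces.
[cite: Pawlucki2024, (5.1.2), (8.1.8)] -/
theorem continuousOn_crPhiD :
    ContinuousOn (fun p : B × ℝ => crPhiD D α r f caseII μ g p.1 p.2) {p : B × ℝ | p.1 ∈ D} := by
  refine continuousOn_of_subtype_prod (fun p hp => hp) ?_
  have hYc : ∀ i, Continuous fun x : ↥D => crBeta α f caseII μ r i (x : B) := fun i =>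
    (H.toCRHyp.continuousOn_crBeta i).restrict
  have hYm : ∀ x : ↥D, Monotone fun j => crBeta α f caseII μ r j (x : B) := fun x =>
    H.toCRHyp.crBeta_monotone x.2
  have h := continuous_frOmegaD_smul_comp (X := ↥D) (Y := fun x j => crBeta α f caseII μ r j (x : B))
    hYc hYm (r := r) (θ' := fun x u => crPsiD D α r f caseII μ g (x : B) u) (L := c)
    H.continuousOn_crPsiD_union fun x j hj t ht => ?_
  · have hc : Continuous fun q : ↥D × ℝ => crPhiD D α r f caseII μ g (q.1 : B) q.2 := by
      unfold crPhiD crOmg crOmgD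
      simpa only [smul_eq_mul] using h
    exact hc.continuousOn
  · rw [Real.norm_eq_abs, abs_of_pos (H.crPsiD_pos_le x.2 hj ht).1]
    exact (H.crPsiD_pos_le x.2 hj ht).2

/-- `φ` is jointly continuous on `D × ℝ`. [cite: Pawlucki2024, (5.1.1)] -/
theorem continuousOn_crPhi :
    ContinuousOn (fun p : B × ℝ => crPhi D α r f caseII μ p.1 p.2) {p : B × ℝ | p.1 ∈ D} := by
  refine continuousOn_of_subtype_prod (fun p hp => hp) ?_
  have hYc : ∀ i, Continuous fun x : ↥D => crBeta α f caseII μ r i (x : B) := fun i =>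
    (H.toCRHyp.continuousOn_crBeta i).restrict
  have hYm : ∀ x : ↥D, Monotone fun j => crBeta α f caseII μ r j (x : B) := fun x =>
    H.toCRHyp.crBeta_monotone x.2
  have hψ : ContinuousOn (fun q : ↥D × ℝ => crPsi D α r f caseII μ (q.1 : B) q.2)
      {q : ↥D × ℝ | q.1 ∈ (univ : Set ↥D) ∧ q.2 ∈ Icc (crBeta α f caseII μ r 0 (q.1 : B))
        (crBeta α f caseII μ r r (q.1 : B))} := by
    refine (continuousOn_subtype_prod (D := D) H.toCRHyp.continuousOn_crPsi).mono fun q hq => ?_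
    exact ⟨q.1.2, hq.2.1, hq.2.2⟩
  have h := continuousOn_comp_frOmega (X := ↥D) (Y := fun x j => crBeta α f caseII μ r j (x : B))
    hYc hYm (r := r) (θ := fun x u => crPsi D α r f caseII μ (x : B) u) (S := univ) hψ
  unfold crPhi crOmg
  exact h.mono fun q _ => Set.mem_univ _

end CRDerivHyp

/-! ### The derivative of `f ∘ Φ` on the `K₁`-pieces -/

/-- The `s`-derivative of `f_ν ∘ Φ`: `φ'(x,s) · g_ν(x, φ(x,s))` (zero at the nodes).
[cite: Pawlucki2024, Lemma 5.1, (5.1.5)] -/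
def crFD [Nonempty B] (D : Set B) (α : ℕ → B → ℝ) (r : ℕ) (f : B → ℝ → Fin d → ℝ)
    (caseII : ℕ → Bool) (μ : ℕ → Fin d) (g : Fin d → B → ℝ → ℝ) (ν : Fin d) (x : B) (s : ℝ) : ℝ :=
  crPhiD D α r f caseII μ g x s * g ν x (crPhi D α r f caseII μ x s)

namespace CRDerivHyp

variable [Nonempty B] [T2Space B] (H : CRDerivHyp D α r f caseII μ g K1 c)
include H

/-- `u`-derivative of `f_ν(x, ψ(x, u))` on an open `K₁`-piece of `β`. [cite: Pawlucki2024, (5.1.5)] -/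
theorem hasDerivAt_f_psi {x : B} (hx : x ∈ D) {i : ℕ} (hiK : i ∈ K1) (hi : i < r) (ν : Fin d)
    {u : ℝ} (hu : u ∈ Ioo (crBeta α f caseII μ r i x) (crBeta α f caseII μ r (i + 1) x)) :
    HasDerivAt (fun u => f x (crPsi D α r f caseII μ x u) ν)
      (g ν x (crPsi D α r f caseII μ x u) * crPsiD D α r f caseII μ g x u) u := by
  have hψ := H.toCRHyp.psi_mem_openPiece hx hi hu
  exact (H.deriv i hiK hi x hx _ hψ ν).comp u (H.hasDerivAt_psi hx hi hu)

omit [T2Space B] in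
/-- The bound `|g_ν(x, ψ) ψ'| ≤ c` on the open `K₁`-pieces (case I: `|g_ν| ≤ c`, `ψ' = 1`;
case II: `|g_ν|/|g_μ| ≤ c`). [cite: Pawlucki2024, Lemma 5.1, (5.1.7)–(5.1.9)] -/
theorem abs_g_psi_mul_le {x : B} (hx : x ∈ D) {i : ℕ} (hiK : i ∈ K1) (hi : i < r) (ν : Fin d)
    {u : ℝ} (hu : u ∈ Ioo (crBeta α f caseII μ r i x) (crBeta α f caseII μ r (i + 1) x)) :
    |g ν x (crPsi D α r f caseII μ x u) * crPsiD D α r f caseII μ g x u| ≤ c := by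
  have hψ := H.toCRHyp.psi_mem_openPiece hx hi hu
  by_cases hc : caseII i = true
  · rw [H.crPsiD_of_caseII hx hi hc hu, abs_mul, abs_inv, abs_abs]
    have hlow := H.caseII_lower i hi hc x hx _ hψ
    have hgpos : 0 < |g (μ i) x (crPsi D α r f caseII μ x u)| := lt_of_lt_of_le (inv_pos.2 H.c_pos) hlow
    rw [← div_eq_mul_inv, div_le_iff₀ hgpos]
    exact H.caseII_dom i hi hc x hx _ hψ ν
  · have hc' := Bool.eq_false_iff.2 hc
    rw [H.crPsiD_of_caseI hx hc' hu, mul_one]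
    exact H.caseI_bound i hiK hi hc' x hx _ hψ ν

/-- **`s`-derivative of `f_ν ∘ Φ` on an open `K₁` source piece.** [cite: Pawlucki2024, (5.1.5)] -/
theorem hasDerivAt_f_crPhi {x : B} (hx : x ∈ D) {i : ℕ} (hiK : i ∈ K1) (hi : i < r) (ν : Fin d)
    {s : ℝ} (hs : s ∈ Ioo (crDelta α f caseII μ r i x) (crDelta α f caseII μ r (i + 1) x)) :
    HasDerivAt (fun s => f x (crPhi D α r f caseII μ x s) ν) (crFD D α r f caseII μ g ν x s) s := by
  have hβm := H.toCRHyp.crBeta_monotone hx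
  have h := hasDerivAt_comp_frOmega_piece hβm hi (θ := fun u => f x (crPsi D α r f caseII μ x u) ν)
    (θ' := fun u => g ν x (crPsi D α r f caseII μ x u) * crPsiD D α r f caseII μ g x u)
    (fun t ht => H.hasDerivAt_f_psi hx hiK hi ν ht) hs
  have h' : HasDerivAt (fun s => f x (crPhi D α r f caseII μ x s) ν) (crFD D α r f caseII μ g ν x s) s := by
    unfold crFD crPhi crPhiD crOmg crOmgD
    refine (h.congr_deriv ?_)
    simp only [smul_eq_mul]
    ring
  exact h'

/-- **The derivative of `f_ν ∘ Φ` extends continuously by zero to the closed `K₁` source piece**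
(pinch points included). [cite: Pawlucki2024, (5.1.5)] -/
theorem continuousOn_crFD {i : ℕ} (hiK : i ∈ K1) (hi : i < r) (ν : Fin d) :
    ContinuousOn (fun p : B × ℝ => crFD D α r f caseII μ g ν p.1 p.2)
      (lamPiece D (crDelta α f caseII μ r) i) := by
  refine continuousOn_of_subtype_prod (fun p hp => hp.1) ?_
  have hYc : ∀ j, Continuous fun x : ↥D => crBeta α f caseII μ r j (x : B) := fun j =>
    (H.toCRHyp.continuousOn_crBeta j).restrict
  have hYm : ∀ x : ↥D, Monotone fun j => crBeta α f caseII μ r j (x : B) := fun x =>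
    H.toCRHyp.crBeta_monotone x.2
  -- continuity of `θ'(x, u) = g_ν(x, ψ(x,u)) ψ'(x,u)` on the open `β`-piece
  have hθ : ContinuousOn (fun q : B × ℝ => g ν q.1 (crPsi D α r f caseII μ q.1 q.2) *
      crPsiD D α r f caseII μ g q.1 q.2) (lamOpenPiece D (crBeta α f caseII μ r) i) := by
    have hmap : ContinuousOn (fun q : B × ℝ => (q.1, crPsi D α r f caseII μ q.1 q.2))
        (lamOpenPiece D (crBeta α f caseII μ r) i) := by
      refine continuousOn_fst.prodMk (H.toCRHyp.continuousOn_crPsi.mono fun q hq => ?_)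
      have hβ := H.toCRHyp.crBeta_monotone hq.1
      exact ⟨hq.1, (hβ (Nat.zero_le i)).trans hq.2.1.le, hq.2.2.le.trans (hβ (Nat.succ_le_of_lt hi))⟩
    have hmaps : MapsTo (fun q : B × ℝ => (q.1, crPsi D α r f caseII μ q.1 q.2))
        (lamOpenPiece D (crBeta α f caseII μ r) i) (lamOpenPiece D α i) := fun q hq =>
      ⟨hq.1, H.toCRHyp.psi_mem_openPiece hq.1 hi ⟨hq.2.1, hq.2.2⟩⟩
    exact ((H.gcont i hiK hi ν).comp hmap hmaps).mul (H.continuousOn_crPsiD hi)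
  have hθ' : ContinuousOn (fun q : ↥D × ℝ => g ν (q.1 : B) (crPsi D α r f caseII μ (q.1 : B) q.2) *
      crPsiD D α r f caseII μ g (q.1 : B) q.2)
      {q : ↥D × ℝ | crBeta α f caseII μ r i (q.1 : B) < q.2 ∧ q.2 < crBeta α f caseII μ r (i + 1) (q.1 : B)} :=
    (continuousOn_subtype_prod (D := D) hθ).mono fun q hq => ⟨q.1.2, hq.1, hq.2⟩
  have h := continuousOn_frOmegaD_smul_comp_piece (X := ↥D)
    (Y := fun x j => crBeta α f caseII μ r j (x : B)) hYc hYm hi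
    (θ' := fun x u => g ν (x : B) (crPsi D α r f caseII μ (x : B) u) * crPsiD D α r f caseII μ g (x : B) u)
    (L := c) hθ' fun x t ht => ?_
  · have h2 : ContinuousOn (fun q : ↥D × ℝ => crFD D α r f caseII μ g ν (q.1 : B) q.2)
        {q : ↥D × ℝ | frNode (fun j => crBeta α f caseII μ r j (q.1 : B)) i ≤ q.2 ∧
          q.2 ≤ frNode (fun j => crBeta α f caseII μ r j (q.1 : B)) (i + 1)} := by
      refine h.congr fun q _ => ?_
      unfold crFD crPhi crPhiD crOmg crOmgD
      simp only [smul_eq_mul]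
      ring
    refine h2.mono fun q hq => ?_
    exact ⟨hq.2.1, hq.2.2⟩
  · rw [Real.norm_eq_abs]
    exact H.abs_g_psi_mul_le x.2 hiK hi ν ht

omit [TopologicalSpace B] [T2Space B] H in
/-- `∂_s(f_ν ∘ Φ)` vanishes at the nodes. [cite: Pawlucki2024, (5.1.5)] -/
theorem crFD_delta (ν : Fin d) (x : B) (i : ℕ) :
    crFD D α r f caseII μ g ν x (crDelta α f caseII μ r i x) = 0 := by
  unfold crFD
  rw [crPhiD_delta, zero_mul]

/-! ### `Φ` is a fibre-preserving homeomorphism of total capsules -/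

omit [TopologicalSpace B] [Nonempty B] [T2Space B] H in
/-- `δ₀ = 0`. [cite: Pawlucki2024, (5.1.3)] -/
theorem crDelta_zero (x : B) : crDelta α f caseII μ r 0 x = 0 := frNode_zero

omit [Nonempty B] [T2Space B] in
/-- The source nodes are continuous on `D`. [cite: Pawlucki2024, Lemma 5.1] -/
theorem continuousOn_crDelta (i : ℕ) : ContinuousOn (crDelta α f caseII μ r i) D := by
  unfold crDelta frNode frW frGap
  refine continuousOn_finsetSum _ fun j _ => ?_
  exact ((H.toCRHyp.continuousOn_crBeta (j + 1)).sub (H.toCRHyp.continuousOn_crBeta j)).sqrt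

omit [TopologicalSpace B] [Nonempty B] [T2Space B] H in
/-- The source nodes are monotone in the index. [cite: Pawlucki2024, Lemma 5.1] -/
theorem crDelta_monotone (x : B) : Monotone fun i => crDelta α f caseII μ r i x :=
  fun _ _ hij => frNode_mono hij

omit [Nonempty B] [T2Space B] in
/-- The source total capsule is compact. [cite: Pawlucki2024, Lemma 5.1] -/
theorem isCompact_lamTotal_delta : IsCompact (lamTotal D (crDelta α f caseII μ r) r) :=
  isCompact_lamTotal H.compact H.continuousOn_crDelta (fun x _ => crDelta_monotone x) r

/-- `Φ` is continuous on `D × ℝ`. [cite: Pawlucki2024, (5.1.1)] -/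
theorem continuousOn_crPhiMap :
    ContinuousOn (fun p : B × ℝ => (p.1, crPhi D α r f caseII μ p.1 p.2)) {p : B × ℝ | p.1 ∈ D} :=
  continuousOn_fst.prodMk H.continuousOn_crPhi

omit [T2Space B] in
/-- `Φ` is injective on the source total capsule `[0, δ_r]`. [cite: Pawlucki2024, (5.1.1)] -/
theorem injOn_crPhiMap :
    InjOn (fun p : B × ℝ => (p.1, crPhi D α r f caseII μ p.1 p.2)) (lamTotal D (crDelta α f caseII μ r) r) := by
  rintro ⟨x, s⟩ hp ⟨x', s'⟩ hq h
  simp only [Prod.mk.injEq] at h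
  obtain ⟨rfl, h⟩ := h
  simp only [Prod.mk.injEq, true_and]
  have h0 : crDelta α f caseII μ r 0 x = 0 := frNode_zero
  have hs : s ∈ Icc 0 (crDelta α f caseII μ r r x) := ⟨by rw [← h0]; exact hp.2.1, hp.2.2⟩
  have hs' : s' ∈ Icc 0 (crDelta α f caseII μ r r x) := ⟨by rw [← h0]; exact hq.2.1, hq.2.2⟩
  exact (H.crPhi_strictMonoOn hp.1).injOn hs hs' h

omit [T2Space B] in
/-- **`Φ` maps the source total capsule ONTO the target total capsule.** [cite: Pawlucki2024, (5.1.1)] -/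
theorem image_crPhiMap :
    (fun p : B × ℝ => (p.1, crPhi D α r f caseII μ p.1 p.2)) '' lamTotal D (crDelta α f caseII μ r) r =
      lamTotal D α r := by
  ext ⟨x, t⟩
  constructor
  · rintro ⟨⟨x', s⟩, hp, h⟩
    simp only [Prod.mk.injEq] at h
    obtain ⟨rfl, rfl⟩ := h
    exact ⟨hp.1, H.crPhi_mem _ hp.1 _⟩
  · rintro ⟨hx, h0, hr⟩
    have hβm := H.toCRHyp.crBeta_monotone hx
    -- `u = η(x,t)`, `s = ω⁻¹(u)`
    set u := crEta α f caseII μ r x t with hu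
    have hu' : u ∈ Icc (crBeta α f caseII μ r 0 x) (crBeta α f caseII μ r r x) :=
      crEta_mem_Icc (H.mono x hx) (H.toCRHyp.weak hx) ⟨h0, hr⟩
    obtain ⟨s, hs, hsu⟩ := surjOn_frOmega hβm r hu'
    refine ⟨(x, s), ⟨hx, ?_, hs.2⟩, ?_⟩
    · exact le_of_eq_of_le frNode_zero hs.1
    · simp only [Prod.mk.injEq, true_and]
      unfold crPhi crOmg
      rw [hsu, hu]
      exact H.toCRHyp.psi_eta ⟨hx, h0, hr⟩

/-- **`Φ` is a homeomorphism `[δ₀, δ_r] → [α₀, α_r]`**: a continuous fibre-preserving inverse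
exists (compactness). [cite: Pawlucki2024, Lemma 5.1, (5.1.1)] -/
theorem exists_inverse_crPhiMap :
    ∃ Ψ : B × ℝ → B × ℝ, ContinuousOn Ψ (lamTotal D α r) ∧
      MapsTo Ψ (lamTotal D α r) (lamTotal D (crDelta α f caseII μ r) r) ∧
      (∀ p ∈ lamTotal D (crDelta α f caseII μ r) r, Ψ (p.1, crPhi D α r f caseII μ p.1 p.2) = p) ∧
      (∀ q ∈ lamTotal D α r, ((Ψ q).1, crPhi D α r f caseII μ (Ψ q).1 (Ψ q).2) = q) ∧
      ∀ q ∈ lamTotal D α r, (Ψ q).1 = q.1 := by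
  obtain ⟨Ψ, hΨc, hΨm, hleft, hright⟩ := exists_continuousOn_inverse_of_isCompact
    H.isCompact_lamTotal_delta (H.continuousOn_crPhiMap.mono fun p hp => hp.1) H.injOn_crPhiMap
    H.image_crPhiMap
  refine ⟨Ψ, hΨc, hΨm, hleft, hright, fun q hq => ?_⟩
  have h := congrArg Prod.fst (hright q hq)
  simpa using h

/-! ### Normal forms on the source pieces ((5.1.6) for `p = 1`) -/

omit [T2Space B] in
/-- **Case I normal form**: `φ(x, s) = α_i(x) + (ω_x(s) - β_i(x))` on the `i`-th source piece.
[cite: Pawlucki2024, Lemma 5.1, (5.1.6) first form] -/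
theorem crPhi_caseI {x : B} (hx : x ∈ D) {i : ℕ} (hi : i < r) (hc : caseII i = false) {s : ℝ}
    (hs : s ∈ Icc (crDelta α f caseII μ r i x) (crDelta α f caseII μ r (i + 1) x)) :
    crPhi D α r f caseII μ x s = α i x + (crOmg α f caseII μ r x s - crBeta α f caseII μ r i x) :=
  H.psi_caseI hx hi hc (H.crOmg_mem_piece hx hi hs)

omit [T2Space B] in
/-- **Case II normal form**: `f_μ(x, φ(x,s)) = f_μ(x, α_i(x)) + σ (ω_x(s) - β_i(x))` on the `i`-th
source piece, with the fibre sign `σ = ±1` (`σ g_μ = |g_μ|`).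
[cite: Pawlucki2024, Lemma 5.1, (5.1.6) second form] -/
theorem f_crPhi_caseII {x : B} (hx : x ∈ D) {i : ℕ} (hi : i < r) (hc : caseII i = true) :
    ∃ σ : ℝ, (σ = 1 ∨ σ = -1) ∧ (∀ t ∈ Ioo (α i x) (α (i + 1) x), σ * g (μ i) x t = |g (μ i) x t|) ∧
      ∀ s ∈ Icc (crDelta α f caseII μ r i x) (crDelta α f caseII μ r (i + 1) x),
        f x (crPhi D α r f caseII μ x s) (μ i) =
          f x (α i x) (μ i) + σ * (crOmg α f caseII μ r x s - crBeta α f caseII μ r i x) := by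
  obtain ⟨σ, hσ, hσg, hform⟩ := H.f_psi_caseII hx hi hc
  exact ⟨σ, hσ, hσg, fun s hs => hform _ (H.crOmg_mem_piece hx hi hs)⟩

omit [TopologicalSpace B] [Nonempty B] [T2Space B] H in
/-- The `β`-gaps are the squares of the `δ`-gaps: `β_{i+1} - β_i = (δ_{i+1} - δ_i)²` (monotone
fibres). [cite: Pawlucki2024, Lemma 5.1, (5.1.6)] -/
theorem crBeta_succ_sub {x : B} (hβm : Monotone fun j => crBeta α f caseII μ r j x) (i : ℕ) :
    crBeta α f caseII μ r (i + 1) x - crBeta α f caseII μ r i x =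
      (crDelta α f caseII μ r (i + 1) x - crDelta α f caseII μ r i x) ^ 2 := by
  unfold crDelta
  rw [frNode_succ, add_sub_cancel_left, frW_sq hβm]
  rfl

omit [TopologicalSpace B] [Nonempty B] [T2Space B] H in
/-- **`ω_x` in terms of the source nodes**: `ω_x(s) = β₀(x) + ∑_{j<r} Π(δ_{j+1} - δ_j, s - δ_j)`
with the `C¹` profile `Π` of block B1 — the form making `(u,s) ↦ ω_{h(u)}(s)` of class `C¹` once
`β₀ ∘ h = α₀ ∘ h` and the `δ_j ∘ h` are. [cite: Pawlucki2024, (5.1.6), (8.1.15)] -/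
theorem crOmg_eq_sum_frPiece {x : B} (hβm : Monotone fun j => crBeta α f caseII μ r j x) (s : ℝ) :
    crOmg α f caseII μ r x s = crBeta α f caseII μ r 0 x +
      ∑ j ∈ range r, frPiece (crDelta α f caseII μ r (j + 1) x - crDelta α f caseII μ r j x,
        s - crDelta α f caseII μ r j x) :=
  frOmega_eq_sum_frPiece hβm r s

end CRDerivHyp

/-! ### The semialgebraic layer (`B = ℝᵐ`, coordinates `z = (x, t)` via `Fin.init` / last) -/

section Semialgebraic


variable {m : ℕ} {D : Set (Fin m → ℝ)} {α : ℕ → (Fin m → ℝ) → ℝ} {r : ℕ}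
  {f : (Fin m → ℝ) → ℝ → Fin d → ℝ} {caseII : ℕ → Bool} {μ : ℕ → Fin d}

/-- A product set `S ⊆ ℝᵐ × ℝ` in the coordinates of `ℝᵐ⁺¹`. [cite: Pawlucki2024, Lemma 5.1] -/
def snocSet (S : Set ((Fin m → ℝ) × ℝ)) : Set (Fin (m + 1) → ℝ) :=
  {z | (Fin.init z, z (Fin.last m)) ∈ S}

omit [TopologicalSpace B] in
/-- Membership in `snocSet`. [cite: Pawlucki2024, Lemma 5.1] -/
@[simp] theorem mem_snocSet {S : Set ((Fin m → ℝ) × ℝ)} {z : Fin (m + 1) → ℝ} :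
    z ∈ snocSet S ↔ (Fin.init z, z (Fin.last m)) ∈ S := Iff.rfl

/-- The total capsule is semialgebraic. [cite: Pawlucki2024, Lemma 5.1] -/
theorem isSemialgebraic_snocSet_lamTotal
    (hα : ∀ j, IsSemialgebraicFunOn ℝ D (α j)) (r : ℕ) :
    IsSemialgebraic ℝ (snocSet (lamTotal D α r)) := by
  have h1 := IsSemialgebraicFunOn.isSemialgebraic_setOf_ge tarski_seidenberg_real_holds (hα 0)
  have h2 := IsSemialgebraicFunOn.isSemialgebraic_setOf_le tarski_seidenberg_real_holds (hα r)
  convert h1.inter h2 using 1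
  ext z
  simp only [mem_snocSet, lamTotal, mem_setOf_eq, mem_inter_iff]
  tauto

/-- A closed piece is semialgebraic. [cite: Pawlucki2024, Lemma 5.1] -/
theorem isSemialgebraic_snocSet_lamPiece
    (hα : ∀ j, IsSemialgebraicFunOn ℝ D (α j)) (i : ℕ) :
    IsSemialgebraic ℝ (snocSet (lamPiece D α i)) := by
  have h1 := IsSemialgebraicFunOn.isSemialgebraic_setOf_ge tarski_seidenberg_real_holds (hα i)
  have h2 := IsSemialgebraicFunOn.isSemialgebraic_setOf_le tarski_seidenberg_real_holds (hα (i + 1))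
  convert h1.inter h2 using 1
  ext z
  simp only [mem_snocSet, lamPiece, mem_setOf_eq, mem_inter_iff]
  tauto

/-- The base cylinder `{z | init z ∈ D}` is semialgebraic. [cite: Pawlucki2024, Lemma 5.1] -/
theorem isSemialgebraic_cyl (hD : IsSemialgebraic ℝ D) :
    IsSemialgebraic ℝ {z : Fin (m + 1) → ℝ | Fin.init z ∈ D} := hD.setOf_init_mem

/-- The fibre-preserving map `z ↦ (init z, v z)` is semialgebraic when `v` is.
[cite: Pawlucki2024, Lemma 5.1] -/
theorem isSemialgebraicMapOn_snoc_init {S : Set (Fin (m + 1) → ℝ)} (hS : IsSemialgebraic ℝ S)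
    {v : (Fin (m + 1) → ℝ) → ℝ} (hv : IsSemialgebraicFunOn ℝ S v) :
    IsSemialgebraicMapOn ℝ S (fun z => (Fin.snoc (Fin.init z) (v z) : Fin (m + 1) → ℝ)) := by
  refine IsSemialgebraicMapOn.of_forall hS fun j => ?_
  refine Fin.lastCases ?_ (fun i => ?_) j
  · simpa only [Fin.snoc_last] using hv
  · simp only [Fin.snoc_castSucc]
    exact (isSemialgebraicFunOn_apply hS (Fin.castSucc i)).congr fun y _ => rfl

/-- Semialgebraicity hypotheses of [Pawlucki2024, Lemma 5.1]: base, laminar family and `f`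
(each component `f_ν` as a function of `z = (x, t)` on the total capsule).
[cite: Pawlucki2024, Lemma 5.1] -/
structure CRSemialg (D : Set (Fin m → ℝ)) (α : ℕ → (Fin m → ℝ) → ℝ) (r : ℕ)
    (f : (Fin m → ℝ) → ℝ → Fin d → ℝ) : Prop where
  base : IsSemialgebraic ℝ D
  lam : ∀ j, IsSemialgebraicFunOn ℝ D (α j)
  fun_ : ∀ ν, IsSemialgebraicFunOn ℝ (snocSet (lamTotal D α r))
    (fun z => f (Fin.init z) (z (Fin.last m)) ν)

namespace CRSemialg

variable (S : CRSemialg D α r f) (hm : ∀ x ∈ D, Monotone fun j => α j x)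
include S hm

omit hm in
/-- The clamp is semialgebraic in `z = (x, t)`. [cite: Pawlucki2024, Lemma 5.1] -/
theorem clamp (i : ℕ) :
    IsSemialgebraicFunOn ℝ {z : Fin (m + 1) → ℝ | Fin.init z ∈ D}
      (fun z => crClamp α i (Fin.init z) (z (Fin.last m))) := by
  have hS := isSemialgebraic_cyl S.base
  unfold crClamp
  exact IsSemialgebraicFunOn.max hS (S.lam i).comp_init
    (IsSemialgebraicFunOn.min hS (isSemialgebraicFunOn_apply hS (Fin.last m)) (S.lam (i + 1)).comp_init)

/-- `z ↦ f_ν(x, clamp_i(x,t))` is semialgebraic on the base cylinder. [cite: Pawlucki2024, Lemma 5.1] -/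
theorem f_clamp {i : ℕ} (hi : i < r) (ν : Fin d) :
    IsSemialgebraicFunOn ℝ {z : Fin (m + 1) → ℝ | Fin.init z ∈ D}
      (fun z => f (Fin.init z) (crClamp α i (Fin.init z) (z (Fin.last m))) ν) := by
  have hS := isSemialgebraic_cyl S.base
  have hmap := isSemialgebraicMapOn_snoc_init hS (S.clamp i)
  have hmaps : MapsTo (fun z : Fin (m + 1) → ℝ => (Fin.snoc (Fin.init z)
      (crClamp α i (Fin.init z) (z (Fin.last m))) : Fin (m + 1) → ℝ))
      {z : Fin (m + 1) → ℝ | Fin.init z ∈ D} (snocSet (lamTotal D α r)) := by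
    intro z hz
    have hx : α i (Fin.init z) ≤ α (i + 1) (Fin.init z) := hm _ hz (Nat.le_succ i)
    have hc := crClamp_mem (α := α) hx (z (Fin.last m))
    simp only [mem_snocSet, Fin.init_snoc, Fin.snoc_last]
    exact lamPiece_subset_lamTotal hm hi ⟨hz, hc.1, hc.2⟩
  have h := IsSemialgebraicFunOn.comp_isSemialgebraicMapOn_holds (S.fun_ ν) hmap hmaps
  refine h.congr fun z _ => ?_
  simp [Function.comp]

/-- `x ↦ f_ν(x, α_i(x))` is semialgebraic on `D`. [cite: Pawlucki2024, Lemma 5.1] -/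
theorem f_node {i : ℕ} (hi : i ≤ r) (ν : Fin d) :
    IsSemialgebraicFunOn ℝ D (fun x => f x (α i x) ν) := by
  have hmap := isSemialgebraicMapOn_snoc S.base (S.lam i)
  have hmaps : MapsTo (fun x : Fin m → ℝ => (Fin.snoc x (α i x) : Fin (m + 1) → ℝ)) D
      (snocSet (lamTotal D α r)) := fun x hx => by
    simp only [mem_snocSet, Fin.init_snoc, Fin.snoc_last]
    exact ⟨hx, hm x hx (Nat.zero_le i), hm x hx hi⟩
  have h := IsSemialgebraicFunOn.comp_isSemialgebraicMapOn_holds (S.fun_ ν) hmap hmaps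
  refine h.congr fun x _ => ?_
  simp [Function.comp]

/-- Each contribution is semialgebraic in `z = (x, t)`. [cite: Pawlucki2024, Lemma 5.1] -/
theorem contrib {i : ℕ} (hi : i < r) :
    IsSemialgebraicFunOn ℝ {z : Fin (m + 1) → ℝ | Fin.init z ∈ D}
      (fun z => crContrib α f caseII μ i (Fin.init z) (z (Fin.last m))) := by
  unfold crContrib
  by_cases hc : caseII i = true
  · simp only [hc, if_true]
    exact (IsSemialgebraicFunOn.sub_holds (S.f_clamp hm hi (μ i)) (S.f_node hm hi.le (μ i)).comp_init).abs
  · simp only [hc, Bool.false_eq_true, if_false]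
    exact IsSemialgebraicFunOn.sub_holds (S.clamp i) (S.lam i).comp_init

/-- **`η` is semialgebraic** in `z = (x, t)` on the base cylinder. [cite: Pawlucki2024, Lemma 5.1] -/
theorem eta :
    IsSemialgebraicFunOn ℝ {z : Fin (m + 1) → ℝ | Fin.init z ∈ D}
      (fun z => crEta α f caseII μ r (Fin.init z) (z (Fin.last m))) := by
  unfold crEta
  refine IsSemialgebraicFunOn.add_holds (S.lam 0).comp_init ?_
  exact IsSemialgebraicFunOn.finset_sum (isSemialgebraic_cyl S.base) _ fun i hi =>
    S.contrib hm (mem_range.1 hi)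

/-- **The new nodes `β_i` are semialgebraic on `D`.** [cite: Pawlucki2024, Lemma 5.1] -/
theorem beta (i : ℕ) : IsSemialgebraicFunOn ℝ D (crBeta α f caseII μ r i) := by
  have hmap := isSemialgebraicMapOn_snoc S.base (S.lam i)
  have hmaps : MapsTo (fun x : Fin m → ℝ => (Fin.snoc x (α i x) : Fin (m + 1) → ℝ)) D
      {z : Fin (m + 1) → ℝ | Fin.init z ∈ D} := fun x hx => by simpa using hx
  have h := IsSemialgebraicFunOn.comp_isSemialgebraicMapOn_holds
    (S.eta (caseII := caseII) (μ := μ) hm) hmap hmaps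
  refine h.congr fun x _ => ?_
  simp [Function.comp, crBeta]

/-- **The source nodes `δ_i` are semialgebraic on `D`.** [cite: Pawlucki2024, Lemma 5.1] -/
theorem delta (i : ℕ) : IsSemialgebraicFunOn ℝ D (crDelta α f caseII μ r i) :=
  isSemialgebraicFunOn_frNode S.base (fun j => S.beta hm j) i

/-- **`ω_x(s)` is semialgebraic** in `(x, s)` on the base cylinder. [cite: Pawlucki2024, Lemma 5.1] -/
theorem omg :
    IsSemialgebraicFunOn ℝ {z : Fin (m + 1) → ℝ | Fin.init z ∈ D}
      (fun z => crOmg α f caseII μ r (Fin.init z) (z (Fin.last m))) :=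
  isSemialgebraicFunOn_frOmega S.base (fun j => S.beta hm j) r

end CRSemialg

/-- **The fibrewise inverse `ψ` is semialgebraic** on the total capsule of `β` (its graph is the
graph of `η` with the last two coordinates swapped). [cite: Pawlucki2024, Lemma 5.1] -/
theorem CRHyp.isSemialgebraicFunOn_psi (H : CRHyp D α r f caseII μ) (S : CRSemialg D α r f) :
    IsSemialgebraicFunOn ℝ (snocSet (lamTotal D (crBeta α f caseII μ r) r))
      (fun w => crPsi D α r f caseII μ (Fin.init w) (w (Fin.last m))) := by
  classical
  rw [isSemialgebraicFunOn_iff]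
  -- the graph of `η` over the total capsule of `α`
  have hT : IsSemialgebraic ℝ (snocSet (lamTotal D α r)) := isSemialgebraic_snocSet_lamTotal S.lam r
  have hΓη : IsSemialgebraic ℝ {p : Fin (m + 1 + 1) → ℝ | Fin.init p ∈ snocSet (lamTotal D α r) ∧
      p (Fin.last (m + 1)) = crEta α f caseII μ r (Fin.init (Fin.init p)) (Fin.init p (Fin.last m))} := by
    have h := ((S.eta (caseII := caseII) (μ := μ) H.mono).mono (fun z hz => hz.1) hT)
    exact isSemialgebraicFunOn_iff.mp h
  have hTβ : IsSemialgebraic ℝ (snocSet (lamTotal D (crBeta α f caseII μ r) r)) :=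
    isSemialgebraic_snocSet_lamTotal (fun j => S.beta (caseII := caseII) (μ := μ) H.mono j) r
  -- swap of the coordinates `m` (the `u`-slot) and `m + 1` (the `t`-slot)
  let σ : Fin (m + 1 + 1) → Fin (m + 1 + 1) :=
    Equiv.swap (Fin.castSucc (Fin.last m)) (Fin.last (m + 1))
  have hpre := hΓη.preimage_comp σ
  convert hTβ.setOf_init_mem.inter hpre using 1
  ext q
  simp only [mem_setOf_eq, mem_inter_iff, Set.mem_preimage]
  -- coordinates of `q ∘ σ`
  have hlast : (q ∘ σ) (Fin.last (m + 1)) = q (Fin.castSucc (Fin.last m)) := by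
    show q (Equiv.swap (Fin.castSucc (Fin.last m)) (Fin.last (m + 1)) (Fin.last (m + 1))) = _
    rw [Equiv.swap_apply_right]
  have hinit_last : Fin.init (q ∘ σ) (Fin.last m) = q (Fin.last (m + 1)) := by
    show q (Equiv.swap (Fin.castSucc (Fin.last m)) (Fin.last (m + 1)) (Fin.castSucc (Fin.last m))) = _
    rw [Equiv.swap_apply_left]
  have hinit_init : Fin.init (Fin.init (q ∘ σ)) = Fin.init (Fin.init q) := by
    funext i
    show q (Equiv.swap (Fin.castSucc (Fin.last m)) (Fin.last (m + 1))
      (Fin.castSucc (Fin.castSucc i))) = q (Fin.castSucc (Fin.castSucc i))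
    rw [Equiv.swap_apply_of_ne_of_ne]
    · intro h
      have h' := congrArg Fin.val h
      simp at h'
      exact absurd h' (Nat.ne_of_lt i.2)
    · intro h
      have h' := congrArg Fin.val h
      simp at h'
      omega
  have hinit : Fin.init (q ∘ σ) = Fin.snoc (Fin.init (Fin.init q)) (q (Fin.last (m + 1))) := by
    rw [← hinit_init, ← hinit_last, Fin.snoc_init_self]
  -- `init q = (x, u)` with `u = q m`
  have hq_init : Fin.init q (Fin.last m) = q (Fin.castSucc (Fin.last m)) := rfl
  rw [hinit, hlast]
  simp only [mem_snocSet, Fin.init_snoc, Fin.snoc_last]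
  constructor
  · rintro ⟨hqβ, hψ⟩
    refine ⟨hqβ, ?_⟩
    have hxu : (Fin.init (Fin.init q), q (Fin.castSucc (Fin.last m))) ∈
        lamTotal D (crBeta α f caseII μ r) r := by
      rw [hq_init] at hqβ; exact hqβ
    have hspec := H.psi_spec hxu
    rw [hq_init] at hψ
    rw [hψ]
    exact ⟨hspec.1, hspec.2.symm⟩
  · rintro ⟨hqβ, hxt, hηu⟩
    refine ⟨hqβ, ?_⟩
    rw [hq_init, hηu]
    exact (H.psi_eta hxt).symm

/-- **`φ` is semialgebraic** in `(x, s)` on the base cylinder. [cite: Pawlucki2024, Lemma 5.1] -/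
theorem CRHyp.isSemialgebraicFunOn_phi (H : CRHyp D α r f caseII μ) (S : CRSemialg D α r f) :
    IsSemialgebraicFunOn ℝ {z : Fin (m + 1) → ℝ | Fin.init z ∈ D}
      (fun z => crPhi D α r f caseII μ (Fin.init z) (z (Fin.last m))) := by
  have hS := isSemialgebraic_cyl S.base
  have hmap := isSemialgebraicMapOn_snoc_init hS (S.omg (caseII := caseII) (μ := μ) H.mono)
  have hmaps : MapsTo (fun z : Fin (m + 1) → ℝ => (Fin.snoc (Fin.init z)
      (crOmg α f caseII μ r (Fin.init z) (z (Fin.last m))) : Fin (m + 1) → ℝ))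
      {z : Fin (m + 1) → ℝ | Fin.init z ∈ D} (snocSet (lamTotal D (crBeta α f caseII μ r) r)) := by
    intro z hz
    simp only [mem_snocSet, Fin.init_snoc, Fin.snoc_last]
    have h := frOmega_mem_Icc (H.crBeta_monotone hz) r (z (Fin.last m))
    exact ⟨hz, h.1, h.2⟩
  have h := IsSemialgebraicFunOn.comp_isSemialgebraicMapOn_holds (H.isSemialgebraicFunOn_psi S) hmap hmaps
  refine h.congr fun z _ => ?_
  simp [Function.comp, crPhi]

/-- **`Φ(x, s) = (x, φ(x, s))` is a semialgebraic map** on the base cylinder. [cite: Pawlucki2024, (5.1.1)] -/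
theorem CRHyp.isSemialgebraicMapOn_phiMap (H : CRHyp D α r f caseII μ) (S : CRSemialg D α r f) :
    IsSemialgebraicMapOn ℝ {z : Fin (m + 1) → ℝ | Fin.init z ∈ D}
      (fun z => (Fin.snoc (Fin.init z) (crPhi D α r f caseII μ (Fin.init z) (z (Fin.last m))) :
        Fin (m + 1) → ℝ)) :=
  isSemialgebraicMapOn_snoc_init (isSemialgebraic_cyl S.base) (H.isSemialgebraicFunOn_phi S)

end Semialgebraic

end FibreSmoothing

end Literature.ModelTheory.ExponentialFields
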